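import Literature.Computability.Cryptography.UnitResidueBounds
import Literature.Computability.Cryptography.UnitResidueMachine
import HarnessLib

/-!
# The register program computes the unit-residue algorithm

Topic `Computability/Cryptography`. This file identifies the register program `prog` of
`UnitResidueMachine.lean` with the abstract algorithm `algo` of `UnitResidueMain.lean`: the statics
of the machine are the parameters `pmOf`, `lpOf`; a machine state is *related* to an abstract state
`s : AS` when its frame registers hold `(a, b)` exactly and the coordinates `p, r` of `θ, θψ` modulo
`m`, and its sign/float registers hold `(sgn, M, E)` (`Rel`); every block function of the machine
carries related states to related states (the coordinates enter only linearly/bilinearly, so the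
congruences pass through `bstep`, `normalize`, `pstep`, `sq`); along the run every register stays
below `2^{13n+67} ≤ 2ᴺ` (frames by the infrastructure invariants, floats by the exponent recursion
`|E| ↦ 2|E| + O(nN)` over `≤ n + 2` levels, `UnitResidueBounds.lean`), so the clamps never fire and
the loops of the program are the iterates of the abstract algorithm. Main result: `run_prog`
(the output registers of the run on `(d, r, m)` with parameter `N`, `64n ≤ N ≤ 128n`, hold
`algo d r m N`).

## References

* M. J. Jacobson Jr., H. C. Williams, *Solving the Pell Equation*, Springer 2009, Ch. 12 (Alg. 12.6),
  §5.3–5.4, §7.4. [JacobsonWilliams2008]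
* S. Arora, B. Barak, *Computational Complexity: A Modern Approach*, CUP 2009, §1.3. [AroraBarak2009]
-/

noncomputable section

open scoped Classical

namespace Literature.Computability.Cryptography.UnitResidue

open Literature.NumberTheory.QuadraticFields.Infra Literature.Computability.Complexity
  Literature.Computability.Complexity.RegProg

/-! ### The statics of the machine are the parameters of the run -/

section Statics

variable (d r m N : ℕ)

/-- The bit size of a natural number, as an integer expression value. [folklore] -/
theorem szZ_natCast (k : ℕ) : szZ k = Nat.size k := by unfold szZ; simp
/-- `szZ` is the (cast of the) size `isize`. [folklore] -/
theorem szZ_eq_isize (z : ℤ) : szZ z = isize z := rfl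
/-- The integer square root of a natural number, as an integer expression value. [folklore] -/
theorem sqZ_natCast (k : ℕ) : sqZ k = Nat.sqrt k := by unfold sqZ; simp
/-- `p2Z N k = 2^k` when the exponent `k ≤ N`. [folklore] -/
theorem p2Z_natCast {N k : ℕ} (hk : k ≤ N) : p2Z N k = 2 ^ k := by unfold p2Z; simp [min_eq_left hk]
/-- `p2Z N z = 2^(z⁺)` when `z⁺ ≤ N`. [folklore] -/
theorem p2Z_toNat {N : ℕ} {z : ℤ} (hk : z.toNat ≤ N) : p2Z N z = 2 ^ z.toNat := by
  unfold p2Z; simp [min_eq_left hk]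

/-- The machine quantity `nZ` agrees with the abstract parameter of the run. [folklore] -/
theorem nZ_eq : nZ d r m = nOf d r m := by unfold nZ nOf; simp only [szZ_natCast]; push_cast; ring

/-- The discriminant of the run is `disc d`. [folklore] -/
@[simp] theorem pmOf_Δ : (pmOf d r m).Δ = disc d := rfl
/-- The precision of the run is `3n + 16`. [folklore] -/
@[simp] theorem pmOf_P : (pmOf d r m).P = 3 * nOf d r m + 16 := rfl
/-- The shift of the run is `4n + 22`. [folklore] -/
@[simp] theorem pmOf_q : (pmOf d r m).q = 4 * nOf d r m + 22 := rfl
/-- `Sq = ⌊√(Δ 4^q)⌋`. [folklore] -/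
theorem pmOf_Sq : (pmOf d r m).Sq = Nat.sqrt (disc d * 4 ^ (4 * nOf d r m + 22)) := rfl
/-- The machine quantity `discZ` agrees with the abstract parameter of the run. [folklore] -/
theorem discZ_eq : discZ d = disc d := by
  unfold discZ disc
  by_cases h : d % 4 = 1
  · have : (d : ℤ) % 4 = 1 := by omega
    simp [h, this]
  · have : (d : ℤ) % 4 ≠ 1 := by omega
    simp [h, this]
/-- The machine quantity `PZ` agrees with the abstract parameter of the run. [folklore] -/
theorem PZ_eq : PZ d r m = (pmOf d r m).P := by unfold PZ; rw [nZ_eq, pmOf_P]; push_cast; ring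
/-- The machine quantity `qZ` agrees with the abstract parameter of the run. [folklore] -/
theorem qZ_eq : qZ d r m = (pmOf d r m).q := by unfold qZ; rw [nZ_eq, pmOf_q]; push_cast; ring
/-- The machine quantity `KZ` agrees with the abstract parameter of the run. [folklore] -/
theorem KZ_eq : KZ d r m = ((2 * nOf d r m + 12 : ℕ) : ℤ) := by unfold KZ; rw [nZ_eq]; push_cast; ring
/-- The machine quantity `c0Z` agrees with the abstract parameter of the run. [folklore] -/
theorem c0Z_eq : c0Z d r m = ((2 * nOf d r m + 8 : ℕ) : ℤ) := by unfold c0Z; rw [nZ_eq]; push_cast; ring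
/-- The machine quantity `SZ` agrees with the abstract parameter of the run. [folklore] -/
theorem SZ_eq : SZ d = Nat.sqrt (disc d) := by unfold SZ; rw [discZ_eq, sqZ_natCast]
/-- The machine quantity `sigZ` agrees with the abstract parameter of the run. [folklore] -/
theorem sigZ_eq : sigZ d = sig (disc d) := by unfold sigZ sig; rw [discZ_eq]; push_cast; rfl
/-- The machine quantity `cwZ` agrees with the abstract parameter of the run. [folklore] -/
theorem cwZ_eq : cwZ d = cw (disc d) := by unfold cwZ cw; rw [sigZ_eq, discZ_eq]
/-- The machine quantity `dKZ` agrees with the abstract parameter of the run. [folklore] -/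
theorem dKZ_eq : dKZ d = discK d := by
  unfold dKZ discK
  by_cases h : d % 4 = 1
  · have : (d : ℤ) % 4 = 1 := by omega
    simp [h, this]
  · have : (d : ℤ) % 4 ≠ 1 := by omega
    simp [h, this]
/-- The machine quantity `b0Z` agrees with the abstract parameter of the run. [folklore] -/
theorem b0Z_eq : b0Z d = b0 (disc d) := by unfold b0Z b0; rw [SZ_eq, sigZ_eq]
/-- The machine quantity `SqZ` agrees with the abstract parameter of the run. [folklore] -/
theorem SqZ_eq {N : ℕ} (hq : 2 * (pmOf d r m).q ≤ N) : SqZ N d r m = (pmOf d r m).Sq := by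
  unfold SqZ
  rw [qZ_eq, discZ_eq, show (2 : ℤ) * ((pmOf d r m).q : ℕ) = ((2 * (pmOf d r m).q : ℕ) : ℤ) by push_cast; ring,
    p2Z_natCast hq]
  have : (disc d : ℤ) * 2 ^ (2 * (pmOf d r m).q) = ((disc d * 4 ^ (pmOf d r m).q : ℕ) : ℤ) := by
    push_cast; rw [pow_mul]; norm_num
  rw [this, sqZ_natCast, pmOf_Sq, pmOf_q]
/-- The machine quantity `cZ` agrees with the abstract parameter of the run. [folklore] -/
theorem cZ_eq (a : ℕ) (b : ℤ) (p q : ℤ × ℤ) : cZ d a b = St.c (disc d) ⟨a, b, p, q⟩ := by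
  unfold cZ St.c; rw [discZ_eq, pow_two]
/-- The machine quantity `bnZ` agrees with the abstract parameter of the run. [folklore] -/
theorem bnZ_eq (a : ℕ) (b : ℤ) (p q : ℤ × ℤ) : bnZ d a b = St.bn (disc d) ⟨a, b, p, q⟩ := by
  unfold bnZ St.bn; rw [SZ_eq]
/-- The machine reduction test is `RedTest`. [folklore] -/
theorem RedTestZ_iff (a : ℕ) (b : ℤ) (p q : ℤ × ℤ) : RedTestZ d a b ↔ RedTest (disc d) ⟨a, b, p, q⟩ := by
  unfold RedTestZ RedTest; rw [SZ_eq]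

/-- `T`, `l` and the prefixes of the machine are those of `lpOf` when `rr = r₂` and `T ≥ 1`. [folklore] -/
theorem TZ_eq (rr : ℤ) : TZ d r m rr = rr - 4 * nOf d r m := by unfold TZ; rw [nZ_eq]

/-- The machine quantity `lZ` agrees with the abstract parameter of the run. [folklore] -/
theorem lZ_eq {T : ℤ} {rr : ℤ} (hT : TZ d r m rr = T) (hT1 : 1 ≤ T) :
    lZ d r m rr = ((Nat.size T.toNat - 1 : ℕ) : ℤ) := by
  unfold lZ; rw [hT]; unfold szZ
  have : 1 ≤ Nat.size T.toNat := Nat.size_pos.mpr (by omega)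
  omega

/-- The machine quantity `prefZ` agrees with the abstract parameter of the run. [folklore] -/
theorem prefZ_eq {N : ℕ} {T rr : ℤ} (hT : TZ d r m rr = T) (hT1 : 1 ≤ T) {l : ℕ} (hl : l = Nat.size T.toNat - 1)
    (hlN : l ≤ N) {k : ℤ} (hk : 0 ≤ k) : prefZ N d r m rr k = pref T l k.toNat := by
  unfold prefZ pref
  rw [lZ_eq d r m hT hT1, ← hl, hT]
  have e : ((l : ℤ) - k).toNat = l - k.toNat := by omega
  rw [p2Z_toNat (by omega), e]

/-- Capped floats are the floats when the shifts fit below `N`. [folklore] -/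
theorem floatOfz_eq {N P : ℕ} {u v : ℤ} (hu : 0 ≤ u) (hcap : isize u + (P + 3 + isize v) ≤ N) :
    floatOfz N P u v = floatOf P u v := by
  have hT : floatTz P u v = (floatT P u v : ℤ) := by
    unfold floatTz floatT; simp only [szZ_eq_isize]; congr 1; omega
  have hTN : floatT P u v ≤ N := (floatT_le P u v).trans (by omega)
  have hM1 : floatM1z N P u v = floatM1 P u v := by
    unfold floatM1z floatM1; rw [hT, p2Z_natCast hTN]
  have hSh : floatShz N P u v = (floatSh P u v : ℤ) := by
    unfold floatShz floatSh; rw [hM1, szZ_eq_isize]; congr 1; omega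
  have hShN : floatSh P u v ≤ N := (floatSh_le v hu).trans hcap
  unfold floatOfz floatOf
  rw [hM1, hSh, hT, p2Z_natCast hShN]

/-- The machine quantity `mulFz` agrees with the abstract parameter of the run. [folklore] -/
theorem mulFz_eq {N P : ℕ} (hP : 2 * P + 1 ≤ N) (M₁ E₁ M₂ E₂ : ℤ) :
    mulFz N P M₁ E₁ M₂ E₂ = mulF P M₁ E₁ M₂ E₂ := by
  unfold mulFz mulMz mulEz mulF
  rw [show (2 : ℤ) * (P : ℕ) + 1 = ((2 * P + 1 : ℕ) : ℤ) by push_cast; ring, p2Z_natCast hP,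
    show (P : ℤ) + 1 = ((P + 1 : ℕ) : ℤ) by push_cast; ring, p2Z_natCast (by omega), p2Z_natCast (by omega)]
  split_ifs <;> rfl

/-- The machine quantity `facUz` agrees with the abstract parameter of the run. [folklore] -/
theorem facUz_eq {N : ℕ} (hq : 2 * (pmOf d r m).q ≤ N) (b : ℤ) : facUz N d r m b = facU (pmOf d r m) b := by
  unfold facUz facU; rw [SqZ_eq d r m hq, qZ_eq, p2Z_natCast (by omega)]

/-- The machine quantity `facVz` agrees with the abstract parameter of the run. [folklore] -/
theorem facVz_eq {N : ℕ} (hq : (pmOf d r m).q + 1 ≤ N) (a : ℕ) : facVz N d r m a = facV (pmOf d r m) a := by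
  unfold facVz facV
  rw [qZ_eq, show ((pmOf d r m).q : ℤ) + 1 = (((pmOf d r m).q + 1 : ℕ) : ℤ) by push_cast; ring, p2Z_natCast hq]

end Statics

/-! ### Related states -/

/-- A machine state is related to an abstract state (for the inputs `d, r, m`): statics, the frame
with `p, r` modulo `m`, the sign and the float. [folklore] -/
structure Rel (d r m : ℕ) (s : AS) (S : MS) : Prop where
  hd : S.d = d
  hr : S.r = r
  hm : S.m = m
  a : S.a = s.fr.a
  b : S.b = s.fr.b
  p1 : S.p1 = s.fr.p.1 % m
  p2 : S.p2 = s.fr.p.2 % m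
  r1 : S.r1 = s.fr.r.1 % m
  r2 : S.r2 = s.fr.r.2 % m
  sgn : S.sgn = s.sgn
  M : S.M = s.M
  E : S.E = s.E

section Steps

variable {d r m N : ℕ} {s : AS} {S : MS}

/-- `disc d` is admissible discriminant data (from the run parameters). [folklore] -/
theorem disc_isDisc' (hpm : (pmOf d r m).OK) : IsDisc (disc d) := hpm.disc

/-- `a mod m mod m = a mod m`. [folklore] -/
theorem emod_emod_nat (a : ℤ) (m : ℕ) : a % m % m = a % m := Int.emod_emod_of_dvd a (dvd_refl (m : ℤ))

/-- Linear combinations pass to residues: `(x (p mod m) + y (q mod m)) mod m = (x p + y q) mod m`. [folklore] -/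
theorem lin_emod (x y p q : ℤ) (m : ℕ) : (x * (p % m) + y * (q % m)) % m = (x * p + y * q) % m :=
  ((Int.mod_modEq p m).mul_left x).add ((Int.mod_modEq q m).mul_left y)

/-- Negation passes to residues. [folklore] -/
theorem neg_emod_emod (p : ℤ) (m : ℕ) : (-(p % m)) % m = (-p) % m := (Int.mod_modEq p m).neg

/-- **The baby step on related states** (frame only: `fstepAS`). [cite: JacobsonWilliams2008, §5.3 Thm 5.18] -/
theorem Rel.bstepM (h : Rel d r m s S) (hI : Inv (disc d) s.fr) (hR : Red (disc d) s.fr) :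
    Rel d r m (fstepAS (disc d) s) S.bstepM := by
  have hc : cZ S.d S.a S.b = s.fr.c (disc d) := by rw [h.hd, h.a, h.b]; exact cZ_eq d _ _ s.fr.p s.fr.r
  have hb' : SZ S.d - (SZ S.d + S.b) % (2 * cZ S.d S.a S.b) = s.fr.b' (disc d) := by
    rw [hc, h.hd, h.b, SZ_eq]; rfl
  have hk : (SZ S.d - (SZ S.d + S.b) % (2 * cZ S.d S.a S.b) + S.b) / (2 * cZ S.d S.a S.b) = s.fr.k (disc d) := by
    rw [hb', hc, h.b]; rfl
  refine ⟨h.hd, h.hr, h.hm, ?_, ?_, ?_, ?_, ?_, ?_, h.sgn, h.M, h.E⟩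
  · show cZ S.d S.a S.b = ((bstep (disc d) s.fr).a : ℤ)
    rw [hI.bstep_a hR, hc]
  · show SZ S.d - (SZ S.d + S.b) % (2 * cZ S.d S.a S.b) = (bstep (disc d) s.fr).b
    rw [bstep_b, hb']
  · show S.r1 % S.m = (bstep (disc d) s.fr).p.1 % m
    rw [bstep_p, h.r1, h.hm, emod_emod_nat]
  · show S.r2 % S.m = (bstep (disc d) s.fr).p.2 % m
    rw [bstep_p, h.r2, h.hm, emod_emod_nat]
  · show (1 * S.p1 + _ * S.r1) % S.m = (bstep (disc d) s.fr).r.1 % m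
    rw [hk, bstep_r, h.p1, h.r1, h.hm, lin_emod]; rfl
  · show (1 * S.p2 + _ * S.r2) % S.m = (bstep (disc d) s.fr).r.2 % m
    rw [hk, bstep_r, h.p2, h.r2, h.hm, lin_emod]; rfl

/-- `n ≥ 4`, and the caps used by the machine fit below `N ≥ 64n`. [folklore] -/
theorem caps (d r m : ℕ) {N : ℕ} (hN : 64 * nOf d r m ≤ N) :
    4 ≤ nOf d r m ∧ Nat.size (disc d) + 2 ≤ nOf d r m ∧ 2 * (pmOf d r m).q ≤ N ∧ (pmOf d r m).q + 1 ≤ N ∧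
      2 * (pmOf d r m).P + 1 ≤ N ∧ (pmOf d r m).P ≤ N ∧ 2 * nOf d r m + 12 ≤ N ∧
      2 * Nat.size (disc d) + 2 * (pmOf d r m).q + (pmOf d r m).P + 6 ≤ N := by
  have h4 : 4 ≤ nOf d r m := by unfold nOf; omega
  have hs := size_disc_le d r m
  simp only [pmOf_P, pmOf_q]
  omega

/-- **The factor-float update on related states.** [cite: JacobsonWilliams2008, §12.1 (EWNEAR)] -/
theorem Rel.mulFacM (h : Rel d r m s S) (hpm : (pmOf d r m).OK) (hN : 64 * nOf d r m ≤ N)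
    (ha : 1 ≤ s.fr.a) (haΔ : s.fr.a ≤ disc d) (hb : |s.fr.b| ≤ 2 * disc d) :
    S.fac N = facF (pmOf d r m) s.fr.a s.fr.b ∧ S.mf N = s.mulFac (pmOf d r m) ∧
      Rel d r m ⟨s.fr, s.sgn, (s.mulFac (pmOf d r m)).1, (s.mulFac (pmOf d r m)).2⟩ (S.mulFacM N) := by
  obtain ⟨_, hsΔ, h2q, hq1, h2P, _, _, hcap⟩ := caps d r m hN
  have hU := hpm.isize_facU_le (b := s.fr.b) (by simpa using hb)
  obtain ⟨_, hV⟩ := isize_facV_le (pm := pmOf d r m) ha (by simpa using haΔ)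
  have hfac : S.fac N = facF (pmOf d r m) s.fr.a s.fr.b := by
    unfold MS.fac facF
    rw [h.hd, h.hr, h.hm, h.a, h.b, PZ_eq, facUz_eq d r m h2q, facVz_eq d r m hq1]
    refine floatOfz_eq (abs_nonneg _) ?_
    simp only [pmOf_Δ, pmOf_P, pmOf_q] at hU hV hcap ⊢
    omega
  have hmf : S.mf N = s.mulFac (pmOf d r m) := by
    unfold MS.mf AS.mulFac
    rw [hfac, h.hd, h.hr, h.hm, h.M, h.E, PZ_eq, mulFz_eq h2P]
  exact ⟨hfac, hmf, ⟨h.hd, h.hr, h.hm, h.a, h.b, h.p1, h.p2, h.r1, h.r2, h.sgn, by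
    show (S.mf N).1 = _; rw [hmf], by show (S.mf N).2 = _; rw [hmf]⟩⟩

/-- **The `ρ`-step on related states.** [cite: JacobsonWilliams2008, §5.1 (5.6)] -/
theorem Rel.pstepM (h : Rel d r m s S) : Rel d r m ⟨pstep (disc d) s.fr, s.sgn, s.M, s.E⟩ S.pstepM := by
  have hc : cZ S.d S.a S.b = s.fr.c (disc d) := by rw [h.hd, h.a, h.b]; exact cZ_eq d _ _ s.fr.p s.fr.r
  refine ⟨h.hd, h.hr, h.hm, ?_, ?_, ?_, ?_, ?_, ?_, h.sgn, h.M, h.E⟩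
  · show |cZ S.d S.a S.b| = ((pstep (disc d) s.fr).a : ℤ)
    rw [pstep_a, hc]
  · show 0 - S.b = (pstep (disc d) s.fr).b
    rw [pstep_b, h.b, zero_sub]
  · show (if 0 < cZ S.d S.a S.b then S.r1 else 0 - S.r1) % S.m = (pstep (disc d) s.fr).p.1 % m
    rw [hc, h.r1, h.hm]
    unfold pstep
    by_cases h0 : 0 < s.fr.c (disc d)
    · rw [if_pos h0, if_pos h0, emod_emod_nat]
    · rw [if_neg h0, if_neg h0, zero_sub, neg_emod_emod]
  · show (if 0 < cZ S.d S.a S.b then S.r2 else 0 - S.r2) % S.m = (pstep (disc d) s.fr).p.2 % m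
    rw [hc, h.r2, h.hm]
    unfold pstep
    by_cases h0 : 0 < s.fr.c (disc d)
    · rw [if_pos h0, if_pos h0, emod_emod_nat]
    · rw [if_neg h0, if_neg h0, zero_sub, neg_emod_emod]
  · show S.p1 % S.m = (pstep (disc d) s.fr).r.1 % m
    rw [pstep_r, h.p1, h.hm, emod_emod_nat]
  · show S.p2 % S.m = (pstep (disc d) s.fr).r.2 % m
    rw [pstep_r, h.p2, h.hm, emod_emod_nat]

/-- The sign update on related states. [folklore] -/
theorem Rel.sgnM (h : Rel d r m s S) :
    Rel d r m ⟨s.fr, if (Nat.sqrt (disc d) : ℤ) < s.fr.b then -s.sgn else s.sgn, s.M, s.E⟩ S.sgnM := by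
  refine ⟨h.hd, h.hr, h.hm, h.a, h.b, h.p1, h.p2, h.r1, h.r2, ?_, h.M, h.E⟩
  show (if SZ S.d < S.b then 0 - S.sgn else S.sgn) = _
  rw [h.hd, h.b, h.sgn, SZ_eq, zero_sub]

/-- **Normalisation on related states.** [folklore] -/
theorem Rel.normM (h : Rel d r m s S) : Rel d r m ⟨normalize (disc d) s.fr, s.sgn, s.M, s.E⟩ S.normM := by
  have hbn : bnZ S.d S.a S.b = s.fr.bn (disc d) := by rw [h.hd, h.a, h.b]; exact bnZ_eq d _ _ s.fr.p s.fr.r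
  have hkn : (bnZ S.d S.a S.b - S.b) / (2 * S.a) = s.fr.kn (disc d) := by rw [hbn, h.b, h.a]; rfl
  refine ⟨h.hd, h.hr, h.hm, h.a, hbn, h.p1, h.p2, ?_, ?_, h.sgn, h.M, h.E⟩
  · show (_ * S.p1 + 1 * S.r1) % S.m = (normalize (disc d) s.fr).r.1 % m
    rw [hkn, normalize_r, h.p1, h.r1, h.hm, lin_emod]; rfl
  · show (_ * S.p2 + 1 * S.r2) % S.m = (normalize (disc d) s.fr).r.2 % m
    rw [hkn, normalize_r, h.p2, h.r2, h.hm, lin_emod]; rfl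

/-- **One reduction round on related states.** [cite: JacobsonWilliams2008, §5.1] -/
theorem Rel.rstepM (h : Rel d r m s S) (hpm : (pmOf d r m).OK) (hN : 64 * nOf d r m ≤ N)
    (ha : 1 ≤ s.fr.a) (haΔ : s.fr.a ≤ disc d) (hb : |s.fr.b| ≤ 2 * disc d) :
    Rel d r m (rstepF (pmOf d r m) s) (S.rstepM N) := by
  unfold rstepF MS.rstepM
  have hiff : RedTestZ S.d S.a S.b ↔ RedTest (pmOf d r m).Δ s.fr := by
    rw [h.hd, h.a, h.b, pmOf_Δ]; exact RedTestZ_iff d _ _ s.fr.p s.fr.r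
  by_cases hred : RedTest (pmOf d r m).Δ s.fr
  · rw [if_pos hred, if_pos (hiff.mpr hred)]; exact h
  · rw [if_neg hred, if_neg (fun h' => hred (hiff.mp h'))]
    obtain ⟨_, _, h1⟩ := h.mulFacM hpm hN ha haΔ hb
    exact ((h1.sgnM).pstepM).normM

/-- **The final-walk round on related states.** [folklore] -/
theorem Rel.finM (h : Rel d r m s S) (hI : Inv (disc d) s.fr) (hR : Red (disc d) s.fr) :
    Rel d r m (finStep (disc d) s) S.finM := by
  unfold finStep MS.finM
  have hiff : S.a = 1 ↔ s.fr.a = 1 := by rw [h.a]; exact_mod_cast Iff.rfl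
  by_cases h1 : s.fr.a = 1
  · rw [if_pos h1, if_pos (hiff.mpr h1)]; exact h
  · rw [if_neg h1, if_neg (fun h' => h1 (hiff.mp h'))]; exact h.bstepM hI hR

/-- **The output registers hold `ε mod m`.** [folklore] -/
theorem Rel.outM (h : Rel d r m s S) :
    S.outM.ox = (s.sgn * pairX d s.fr.p) % m ∧ S.outM.oy = (s.sgn * pairY d s.fr.p) % m := by
  constructor
  · show S.sgn * (2 * S.p1 + sigZ S.d * S.p2) % S.m = _
    rw [h.sgn, h.p1, h.p2, h.hd, h.hm, sigZ_eq]
    unfold pairX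
    exact (((Int.mod_modEq _ _).mul_left 2).add ((Int.mod_modEq _ _).mul_left _)).mul_left _
  · show S.sgn * (dKZ S.d * S.p2) % S.m = _
    rw [h.sgn, h.p2, h.hd, h.hm, dKZ_eq]
    unfold pairY
    exact ((Int.mod_modEq _ _).mul_left _).mul_left _

/-- **The initial state**: after `r₂ := r 2^K / acc` with `acc = ln2K K`, the machine holds `s₀`.
[cite: JacobsonWilliams2008, §12.2] -/
theorem rel_initM (hN : 64 * nOf d r m ≤ N) (hd : S.d = d) (hr : S.r = r) (hm : S.m = m)
    (hacc : S.acc = ln2K (2 * nOf d r m + 12)) :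
    Rel d r m (s0 (pmOf d r m)) (S.initM N) ∧ (S.initM N).rr = r2 r (2 * nOf d r m + 12) ∧
      (S.initM N).i = S.i ∧ (S.initM N).k0 = S.k0 ∧ (S.initM N).g = S.g ∧ (S.initM N).nu = S.nu ∧
      (S.initM N).lam = S.lam ∧ (S.initM N).u = S.u ∧ (S.initM N).v = S.v ∧ (S.initM N).w = S.w ∧
      (S.initM N).t = S.t ∧ (S.initM N).ox = S.ox ∧ (S.initM N).oy = S.oy ∧ (S.initM N).acc = S.acc := by
  obtain ⟨_, _, _, _, _, hP, hK, _⟩ := caps d r m hN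
  refine ⟨⟨hd, hr, hm, rfl, ?_, ?_, ?_, ?_, ?_, rfl, ?_, ?_⟩, ?_, rfl, rfl, rfl, rfl, rfl, rfl, rfl, rfl, rfl, rfl, rfl, rfl⟩
  · show b0Z S.d = (F0 (pmOf d r m).Δ).b
    rw [hd, b0Z_eq]; rfl
  · show 1 % S.m = (F0 (pmOf d r m).Δ).p.1 % m
    rw [hm]; rfl
  · show 0 % S.m = (F0 (pmOf d r m).Δ).p.2 % m
    rw [hm]; rfl
  · show (b0Z S.d - sigZ S.d) / 2 % S.m = (F0 (pmOf d r m).Δ).r.1 % m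
    rw [hd, hm, b0Z_eq, sigZ_eq]; rfl
  · show 1 % S.m = (F0 (pmOf d r m).Δ).r.2 % m
    rw [hm]; rfl
  · show p2Z N (PZ S.d S.r S.m) = 2 ^ (pmOf d r m).P
    rw [hd, hr, hm, PZ_eq, p2Z_natCast hP]
  · show 0 - PZ S.d S.r S.m = -((pmOf d r m).P : ℤ)
    rw [hd, hr, hm, PZ_eq, zero_sub]
  · show S.r * p2Z N (KZ S.d S.r S.m) / S.acc = r2 r (2 * nOf d r m + 12)
    rw [hd, hr, hm, KZ_eq, p2Z_natCast hK, hacc]; rfl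

/-- Partial sums of `ln2K`. [folklore] -/
def ln2P (K i : ℕ) : ℤ := ∑ j ∈ Finset.range i, (2 : ℤ) ^ K / ((j + 1) * 2 ^ (j + 1))

/-- The full partial sum is `ln2K`. [folklore] -/
theorem ln2P_K (K : ℕ) : ln2P K K = ln2K K := rfl

/-- **One round of the `ln2K` loop.** [folklore] -/
theorem ln2M_spec (hN : 64 * nOf d r m ≤ N) (hd : S.d = d) (hr : S.r = r) (hm : S.m = m) {i : ℕ}
    (hi : S.i = min i (2 * nOf d r m + 12)) (hacc : S.acc = ln2P (2 * nOf d r m + 12) (min i (2 * nOf d r m + 12))) :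
    S.ln2M N = { S with
      i := ((min (i + 1) (2 * nOf d r m + 12) : ℕ) : ℤ)
      acc := ln2P (2 * nOf d r m + 12) (min (i + 1) (2 * nOf d r m + 12)) } := by
  obtain ⟨_, _, _, _, _, _, hK, _⟩ := caps d r m hN
  set K := 2 * nOf d r m + 12 with hKdef
  unfold MS.ln2M
  rw [hd, hr, hm, KZ_eq, ← hKdef, hi]
  by_cases hlt : i < K
  · rw [min_eq_left hlt.le] at hacc ⊢
    rw [if_pos (by exact_mod_cast hlt), min_eq_left (by omega : i + 1 ≤ K), hacc, p2Z_natCast hK,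
      show (i : ℤ) + 1 = ((i + 1 : ℕ) : ℤ) by push_cast; ring, p2Z_natCast (by omega)]
    congr 1
    · unfold ln2P; rw [Finset.sum_range_succ]; push_cast; ring
  · push Not at hlt
    rw [min_eq_right hlt] at hacc ⊢
    rw [if_neg (by omega), min_eq_right (by omega)]
    cases S; simp_all

/-- **One round of the `kz` loop.** [folklore] -/
theorem kzM_spec (hd : S.d = d) (hr : S.r = r) (hm : S.m = m) {T : ℤ}
    (hT : TZ d r m S.rr = T) (hT1 : 1 ≤ T) {l : ℕ} (hl : l = Nat.size T.toNat - 1) (hlN : l ≤ N) {k : ℕ}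
    (hk : S.k0 = k) :
    (S.kzM N).k0 = ((if pref T l k < (2 * nOf d r m + 8 : ℕ) + 1 ∧ k < l then k + 1 else k : ℕ) : ℤ) := by
  show (if prefZ N S.d S.r S.m S.rr S.k0 < c0Z S.d S.r S.m + 1 ∧ S.k0 < lZ S.d S.r S.m S.rr then S.k0 + 1 else S.k0) = _
  rw [hd, hr, hm, hk, prefZ_eq d r m hT hT1 hl hlN (by positivity), c0Z_eq, lZ_eq d r m hT hT1, ← hl,
    Int.toNat_natCast]
  by_cases hc : pref T l k < (2 * nOf d r m + 8 : ℕ) + 1 ∧ k < l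
  · rw [if_pos hc, if_pos (by exact_mod_cast hc)]; push_cast; ring
  · rw [if_neg hc, if_neg (by exact_mod_cast hc)]

/-- **One guarded baby step on related states.** [cite: JacobsonWilliams2008, §12.1 (EWNEAR)] -/
theorem Rel.gstepM (h : Rel d r m s S) (hpm : (pmOf d r m).OK) (hN : 64 * nOf d r m ≤ N)
    (hI : Inv (disc d) s.fr) (hR : Red (disc d) s.fr) {T : ℤ} (hT : TZ d r m S.rr = T) (hT1 : 1 ≤ T) {l : ℕ}
    (hl : l = Nat.size T.toNat - 1) (hlN : l ≤ N) {k₀ i : ℕ} (hk : S.k0 = k₀) (hi : S.i = i) :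
    Rel d r m (gstep (pmOf d r m) (pref T l (k₀ + i) - (2 * nOf d r m + 8 : ℕ)) s) (S.gstepM N) ∧
      (S.gstepM N).rr = S.rr ∧ (S.gstepM N).k0 = S.k0 ∧ (S.gstepM N).i = S.i ∧ (S.gstepM N).g = S.g ∧
      (S.gstepM N).nu = S.nu ∧ (S.gstepM N).lam = S.lam ∧ (S.gstepM N).acc = S.acc ∧
      (S.gstepM N).ox = S.ox ∧ (S.gstepM N).oy = S.oy := by
  obtain ⟨haΔ, hb⟩ := Red.frame_bounds (disc_isDisc' hpm) hR
  have hguard : (S.E + PZ S.d S.r S.m < prefZ N S.d S.r S.m S.rr (S.k0 + S.i) - c0Z S.d S.r S.m) ↔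
      ilog (pmOf d r m) s < pref T l (k₀ + i) - (2 * nOf d r m + 8 : ℕ) := by
    rw [h.hd, h.hr, h.hm, h.E, hk, hi, PZ_eq, c0Z_eq, show (k₀ : ℤ) + i = ((k₀ + i : ℕ) : ℤ) by push_cast; ring,
      prefZ_eq d r m hT hT1 hl hlN (by positivity), Int.toNat_natCast]
    rfl
  unfold gstep MS.gstepM
  by_cases hg : ilog (pmOf d r m) s < pref T l (k₀ + i) - (2 * nOf d r m + 8 : ℕ)
  · rw [if_pos hg, if_pos (hguard.mpr hg)]
    obtain ⟨_, _, h1⟩ := h.mulFacM hpm hN hI.1 haΔ hb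
    exact ⟨h1.bstepM hI hR, rfl, rfl, rfl, rfl, rfl, rfl, rfl, rfl, rfl⟩
  · rw [if_neg hg, if_neg (fun h' => hg (hguard.mp h'))]
    exact ⟨h, rfl, rfl, rfl, rfl, rfl, rfl, rfl, rfl, rfl⟩

/-! ### The extended-Euclid loops and the squaring step -/

/-- The registers outside the Euclid state `(u, v, w, t)` and its scratch `(ox, oy)`. [folklore] -/
def MS.euFrame (S : MS) : MS := { S with u := 0, v := 0, w := 0, t := 0, ox := 0, oy := 0 }

/-- A machine state carries the Euclid state `st` over the frame of `F`. [folklore] -/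
structure EuRel (F : MS) (st : ℤ × ℤ × ℤ × ℤ) (S : MS) : Prop where
  frame : S.euFrame = F.euFrame
  u : S.u = st.1
  v : S.v = st.2.1
  w : S.w = st.2.2.1
  t : S.t = st.2.2.2

/-- The Euclid-state relation under `step`. [folklore] -/
theorem EuRel.step {F S : MS} {st : ℤ × ℤ × ℤ × ℤ} (h : EuRel F st S) (x : ℤ) :
    EuRel F (invStep x st) (S.invM x) := by
  obtain ⟨hf, hu, hv, hw, ht⟩ := h
  unfold invStep MS.invM
  by_cases hz : st.2.1 = 0
  · rw [if_pos hz, if_pos (hv.trans hz)]; exact ⟨hf, hu, hv, hw, ht⟩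
  · rw [if_neg hz, if_neg (fun h' => hz (hv.symm.trans h'))]
    exact ⟨hf, hv, by simp [hu, hv], ht, by simp [hu, hv, hw, ht]⟩

/-- Iterating a Euclid round whose modulus is read off the (unchanged) frame. [folklore] -/
theorem EuRel.iterate {F S : MS} {st : ℤ × ℤ × ℤ × ℤ} (h : EuRel F st S) {g : MS → ℤ} {x : ℤ}
    (hg : ∀ X : MS, X.euFrame = F.euFrame → g X = x) (k : ℕ) :
    EuRel F ((invStep x)^[k] st) ((fun X : MS => X.invM (g X))^[k] S) := by
  induction k with
  | zero => exact h
  | succ k ih =>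
    rw [Function.iterate_succ_apply', Function.iterate_succ_apply', hg _ ih.frame]
    exact ih.step x

/-- Frame registers are read off `euFrame`. [folklore] -/
theorem MS.euFrame_a (X : MS) : X.euFrame.a = X.a := rfl
/-- `g` is read off `euFrame`. [folklore] -/
theorem MS.euFrame_g (X : MS) : X.euFrame.g = X.g := rfl

/-- Machine function `MS.eu1`: the effect of the corresponding block on a register file. [folklore] -/
def MS.eu1 (N : ℕ) (S : MS) : MS := (fun X : MS => X.invM X.a)^[N] S
/-- Machine function `MS.eu2`: the effect of the corresponding block on a register file. [folklore] -/
def MS.eu2 (N : ℕ) (S : MS) : MS := (fun X : MS => X.invM (X.a / X.g))^[N] S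
/-- Machine function `MS.eu3`: the effect of the corresponding block on a register file. [folklore] -/
def MS.eu3 (N : ℕ) (S : MS) : MS := (fun X : MS => X.invM X.g)^[N] S

/-- **The machine squaring step** (three Euclid loops, then `sqPost`). [cite: JacobsonWilliams2008, §5.4 (NUCOMP)] -/
def MS.sqM (N : ℕ) (S : MS) : MS := ((((((S.loadA).eu1 N).mid1).eu2 N).mid2).eu3 N).sqPostM N

/-- Congruence of `omul` coordinates. [folklore] -/
theorem omZ_modEq {dd : ℤ} {Δ : ℕ} (hcw : cwZ dd = cw Δ) (hsig : sigZ dd = sig Δ) {n : ℤ} {x y x' y' : ℤ × ℤ}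
    (h1 : x'.1 ≡ x.1 [ZMOD n]) (h2 : x'.2 ≡ x.2 [ZMOD n]) (h3 : y'.1 ≡ y.1 [ZMOD n]) (h4 : y'.2 ≡ y.2 [ZMOD n]) :
    (omZ dd x' y').1 ≡ (omul Δ x y).1 [ZMOD n] ∧ (omZ dd x' y').2 ≡ (omul Δ x y).2 [ZMOD n] := by
  unfold omZ omul
  rw [hcw, hsig]
  exact ⟨(h1.mul h3).add ((h2.mul_left _).mul h4), ((h1.mul h4).add (h2.mul h3)).add ((h2.mul_left _).mul h4)⟩

/-- The data passed from the Euclid loops to `sqPost`. [folklore] -/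
structure SqRel (d r m N : ℕ) (s : AS) (S : MS) : Prop extends Rel d r m s S where
  g : S.g = s.fr.g
  nu : S.nu = (sqData (pmOf d r m) s.fr N).1.2
  w : S.w = (sqData (pmOf d r m) s.fr N).2.2

/-- **`sqPost` on related states computes `sqF`.** [cite: JacobsonWilliams2008, §5.4, §12.2] -/
theorem SqRel.sqPostM (h : SqRel d r m N s S) (hpm : (pmOf d r m).OK) (hN : 64 * nOf d r m ≤ N) {ε : ℝ}
    (hg : Good (pmOf d r m) s ε) :
    Rel d r m (sqF (pmOf d r m) N s) (S.sqPostM N) := by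
  obtain ⟨_, hsΔ, _, _, h2P, _, _, _⟩ := caps d r m hN
  obtain ⟨_, _, _, hg1, hgΔ, _, _, _, _, _, _⟩ := hpm.sq_frame_bounds hg N
  have hI := hg.inv
  set pm := pmOf d r m with hpmdef
  set D := sqData pm s.fr N with hD
  have hΔ : pm.Δ = disc d := rfl
  have hP : pm.P = 3 * nOf d r m + 16 := rfl
  rw [hΔ] at hgΔ
  have hA : ((sqF pm N s).fr.a : ℤ) = s.fr.a1 ^ 2 := hI.sq_a _ _ _ _
  have ha1 : S.a / S.g = s.fr.a1 := by rw [h.a, h.g]; rfl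
  have hb1 : S.b / S.g = s.fr.b1 := by rw [h.b, h.g]; rfl
  have hc : cZ S.d S.a S.b = s.fr.c (disc d) := by rw [h.hd, h.a, h.b]; exact cZ_eq d _ _ s.fr.p s.fr.r
  have hmu : (1 - S.nu * (S.b / S.g)) / (S.a / S.g) = D.1.1 := by rw [hb1, ha1, h.nu]; rfl
  have hka : (1 - S.w * cZ S.d S.a S.b) / S.g = D.2.1 := by rw [hc, h.g, h.w]; rfl
  have hcw : cwZ S.d = cw (disc d) := by rw [h.hd, cwZ_eq]
  have hsig : sigZ S.d = sig (disc d) := by rw [h.hd, sigZ_eq]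
  have hp1 : S.p1 ≡ s.fr.p.1 [ZMOD m] := by rw [h.p1]; exact Int.mod_modEq _ _
  have hp2 : S.p2 ≡ s.fr.p.2 [ZMOD m] := by rw [h.p2]; exact Int.mod_modEq _ _
  have hr1 : S.r1 ≡ s.fr.r.1 [ZMOD m] := by rw [h.r1]; exact Int.mod_modEq _ _
  have hr2 : S.r2 ≡ s.fr.r.2 [ZMOD m] := by rw [h.r2]; exact Int.mod_modEq _ _
  obtain ⟨PP1, PP2⟩ := omZ_modEq hcw hsig (x := s.fr.p) (y := s.fr.p) (x' := (S.p1, S.p2)) (y' := (S.p1, S.p2))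
    hp1 hp2 hp1 hp2
  obtain ⟨PR1, PR2⟩ := omZ_modEq hcw hsig (x := s.fr.p) (y := s.fr.r) (x' := (S.p1, S.p2)) (y' := (S.r1, S.r2))
    hp1 hp2 hr1 hr2
  obtain ⟨RR1, RR2⟩ := omZ_modEq hcw hsig (x := s.fr.r) (y := s.fr.r) (x' := (S.r1, S.r2)) (y' := (S.r1, S.r2))
    hr1 hr2 hr1 hr2
  -- floats
  have hF1 : mulFz N (PZ S.d S.r S.m) S.M S.E S.M S.E = mulF pm.P s.M s.E s.M s.E := by
    rw [h.hd, h.hr, h.hm, h.M, h.E, PZ_eq, mulFz_eq h2P]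
  have hfg : floatOfz N (PZ S.d S.r S.m) 1 S.g = floatOf pm.P 1 s.fr.g := by
    rw [h.hd, h.hr, h.hm, h.g, PZ_eq]
    refine floatOfz_eq zero_le_one ?_
    have : isize s.fr.g ≤ Nat.size (disc d) := by
      rw [isize_le_iff (by omega)]
      have : ((disc d : ℕ) : ℤ) < 2 ^ Nat.size (disc d) := by exact_mod_cast Nat.lt_size_self (disc d)
      omega
    have h1 : isize 1 = 1 := rfl
    rw [hP]; omega
  refine ⟨h.hd, h.hr, h.hm, ?_, ?_, ?_, ?_, ?_, ?_, rfl, ?_, ?_⟩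
  · show S.a / S.g * (S.a / S.g) = ((sqF pm N s).fr.a : ℤ)
    rw [ha1, hA, pow_two]
  · show S.b + 2 * S.nu * (S.a / S.g) * cZ S.d S.a S.b = (sqF pm N s).fr.b
    rw [ha1, hc, h.b, h.nu]; rfl
  · show (1 * ((1 - S.w * cZ S.d S.a S.b) / S.g * (omZ S.d (S.p1, S.p2) (S.p1, S.p2)).1 +
        (0 - S.b / S.g * S.w) * (omZ S.d (S.p1, S.p2) (S.r1, S.r2)).1) +
        S.a / S.g * S.w * (omZ S.d (S.r1, S.r2) (S.r1, S.r2)).1) % S.m = (sqF pm N s).fr.p.1 % m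
    rw [hka, ha1, hb1, h.w, h.hm, zero_sub]
    exact ((((PP1.mul_left _).add (PR1.mul_left _)).mul_left 1).add (RR1.mul_left _))
  · show (1 * ((1 - S.w * cZ S.d S.a S.b) / S.g * (omZ S.d (S.p1, S.p2) (S.p1, S.p2)).2 +
        (0 - S.b / S.g * S.w) * (omZ S.d (S.p1, S.p2) (S.r1, S.r2)).2) +
        S.a / S.g * S.w * (omZ S.d (S.r1, S.r2) (S.r1, S.r2)).2) % S.m = (sqF pm N s).fr.p.2 % m
    rw [hka, ha1, hb1, h.w, h.hm, zero_sub]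
    exact ((((PP2.mul_left _).add (PR2.mul_left _)).mul_left 1).add (RR2.mul_left _))
  · show ((1 - S.nu * (S.b / S.g)) / (S.a / S.g) * (omZ S.d (S.p1, S.p2) (S.r1, S.r2)).1 +
        S.nu * (omZ S.d (S.r1, S.r2) (S.r1, S.r2)).1) % S.m = (sqF pm N s).fr.r.1 % m
    rw [hmu, h.nu, h.hm]
    exact (PR1.mul_left _).add (RR1.mul_left _)
  · show ((1 - S.nu * (S.b / S.g)) / (S.a / S.g) * (omZ S.d (S.p1, S.p2) (S.r1, S.r2)).2 +
        S.nu * (omZ S.d (S.r1, S.r2) (S.r1, S.r2)).2) % S.m = (sqF pm N s).fr.r.2 % m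
    rw [hmu, h.nu, h.hm]
    exact (PR2.mul_left _).add (RR2.mul_left _)
  · show mulMz N (PZ S.d S.r S.m) (mulFz N (PZ S.d S.r S.m) S.M S.E S.M S.E).1
        (floatOfz N (PZ S.d S.r S.m) 1 S.g).1 = (sqF pm N s).M
    have := mulFz_eq (N := N) h2P (mulF pm.P s.M s.E s.M s.E).1 (mulF pm.P s.M s.E s.M s.E).2
      (floatOf pm.P 1 s.fr.g).1 (floatOf pm.P 1 s.fr.g).2
    rw [hF1, hfg, h.hd, h.hr, h.hm, PZ_eq]
    unfold mulFz at this
    exact (congrArg Prod.fst this).trans rfl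
  · show mulEz N (PZ S.d S.r S.m) (mulFz N (PZ S.d S.r S.m) S.M S.E S.M S.E).1
        (mulFz N (PZ S.d S.r S.m) S.M S.E S.M S.E).2 (floatOfz N (PZ S.d S.r S.m) 1 S.g).1
        (floatOfz N (PZ S.d S.r S.m) 1 S.g).2 = (sqF pm N s).E
    have := mulFz_eq (N := N) h2P (mulF pm.P s.M s.E s.M s.E).1 (mulF pm.P s.M s.E s.M s.E).2
      (floatOf pm.P 1 s.fr.g).1 (floatOf pm.P 1 s.fr.g).2
    rw [hF1, hfg, h.hd, h.hr, h.hm, PZ_eq]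
    unfold mulFz at this
    exact (congrArg Prod.snd this).trans rfl

/-- Related states only depend on the frame registers. [folklore] -/
theorem Rel.of_euFrame {F X : MS} (h : Rel d r m s F) (e : X.euFrame = F.euFrame) : Rel d r m s X := by
  have e1 : X.d = F.d := (congrArg MS.d e :)
  have e2 : X.r = F.r := (congrArg MS.r e :)
  have e3 : X.m = F.m := (congrArg MS.m e :)
  have e4 : X.a = F.a := (congrArg MS.a e :)
  have e5 : X.b = F.b := (congrArg MS.b e :)
  have e6 : X.p1 = F.p1 := (congrArg MS.p1 e :)
  have e7 : X.p2 = F.p2 := (congrArg MS.p2 e :)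
  have e8 : X.r1 = F.r1 := (congrArg MS.r1 e :)
  have e9 : X.r2 = F.r2 := (congrArg MS.r2 e :)
  have e10 : X.sgn = F.sgn := (congrArg MS.sgn e :)
  have e11 : X.M = F.M := (congrArg MS.M e :)
  have e12 : X.E = F.E := (congrArg MS.E e :)
  exact ⟨e1.trans h.hd, e2.trans h.hr, e3.trans h.hm, e4.trans h.a, e5.trans h.b, e6.trans h.p1, e7.trans h.p2,
    e8.trans h.r1, e9.trans h.r2, e10.trans h.sgn, e11.trans h.M, e12.trans h.E⟩

/-- Related states are carried to related states by `loadA`. [folklore] -/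
theorem Rel.loadA (h : Rel d r m s S) : Rel d r m s S.loadA :=
  ⟨h.hd, h.hr, h.hm, h.a, h.b, h.p1, h.p2, h.r1, h.r2, h.sgn, h.M, h.E⟩
/-- Related states are carried to related states by `mid1`. [folklore] -/
theorem Rel.mid1 (h : Rel d r m s S) : Rel d r m s S.mid1 :=
  ⟨h.hd, h.hr, h.hm, h.a, h.b, h.p1, h.p2, h.r1, h.r2, h.sgn, h.M, h.E⟩
/-- Related states are carried to related states by `mid2`. [folklore] -/
theorem Rel.mid2 (h : Rel d r m s S) : Rel d r m s S.mid2 :=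
  ⟨h.hd, h.hr, h.hm, h.a, h.b, h.p1, h.p2, h.r1, h.r2, h.sgn, h.M, h.E⟩

/-- The bookkeeping registers `rr, k₀, i, acc` of a state. [folklore] -/
def MS.book (S : MS) : ℤ × ℤ × ℤ × ℤ := (S.rr, S.k0, S.i, S.acc)

/-- States with the same frame have the same bookkeeping registers. [folklore] -/
theorem MS.book_of_euFrame {X F : MS} (e : X.euFrame = F.euFrame) : X.book = F.book := by
  have h1 : X.rr = F.rr := (congrArg MS.rr e :)
  have h2 : X.k0 = F.k0 := (congrArg MS.k0 e :)
  have h3 : X.i = F.i := (congrArg MS.i e :)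
  have h4 : X.acc = F.acc := (congrArg MS.acc e :)
  unfold MS.book
  rw [h1, h2, h3, h4]

/-- What the three Euclid loops deliver: unchanged frames, `g`, `ν`, `λ`. [folklore] -/
structure SqLoops (d r m N : ℕ) (s : AS) (S : MS) : Prop where
  f1 : (S.loadA.eu1 N).euFrame = S.loadA.euFrame
  u1 : (S.loadA.eu1 N).u = s.fr.g
  f2 : ((S.loadA.eu1 N).mid1.eu2 N).euFrame = (S.loadA.eu1 N).mid1.euFrame
  w2 : ((S.loadA.eu1 N).mid1.eu2 N).w = (sqData (pmOf d r m) s.fr N).1.2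
  f3 : (((S.loadA.eu1 N).mid1.eu2 N).mid2.eu3 N).euFrame = ((S.loadA.eu1 N).mid1.eu2 N).mid2.euFrame
  sq : SqRel d r m N s (((S.loadA.eu1 N).mid1.eu2 N).mid2.eu3 N)

/-- **The three Euclid loops deliver `g`, `ν`, `λ`.** [cite: JacobsonWilliams2008, §5.4; KnuthTAOCP2, §4.5.2] -/
theorem Rel.sq_loops (h : Rel d r m s S) (hpm : (pmOf d r m).OK) (hN : 64 * nOf d r m ≤ N) {ε : ℝ}
    (hg : Good (pmOf d r m) s ε) : SqLoops d r m N s S := by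
  obtain ⟨_, hsΔ, _, _, _, _, _, _⟩ := caps d r m hN
  obtain ⟨_, _, _, hg1, hgΔ, ha1, _, hb1, hb1Δ, hc1, hcΔ⟩ := hpm.sq_frame_bounds hg N
  have hI := hg.inv
  have hR := hg.red
  have hΔlt : ((disc d : ℕ) : ℤ) < 2 ^ Nat.size (disc d) := by exact_mod_cast Nat.lt_size_self (disc d)
  obtain ⟨haΔ, hbΔ⟩ := Red.frame_bounds (Δ := disc d) hpm.disc hR
  have hb0 : 0 ≤ s.fr.b := by have := hR.b_pos; omega
  -- loop 1: gcd
  set S1 := S.loadA with hS1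
  have E1 : EuRel S1 ((invStep (s.fr.a : ℤ))^[N] (s.fr.a, s.fr.b, 0, 1 % (s.fr.a : ℤ))) (S1.eu1 N) := by
    have et : S1.t = 1 % (s.fr.a : ℤ) := by show 1 % S.a = _; rw [h.a]
    have h0 : EuRel S1 ((s.fr.a : ℤ), s.fr.b, 0, 1 % (s.fr.a : ℤ)) S1 := ⟨rfl, h.a, h.b, rfl, et⟩
    refine h0.iterate (g := fun X => X.a) (fun X hX => ?_) N
    have e : X.a = S1.a := (congrArg MS.a hX :)
    exact e.trans h.a
  have hgcd : (S1.eu1 N).u = s.fr.g := by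
    rw [E1.u, euclid_fst_eq_gcd (by exact_mod_cast hI.1) hb0]
    · rfl
    · have : isize s.fr.b ≤ Nat.size (disc d) + 1 := by
        rw [isize_le_iff hb0, pow_succ]; rw [abs_le] at hbΔ; omega
      omega
  have R1 : Rel d r m s (S1.eu1 N) := h.loadA.of_euFrame E1.frame
  -- loop 2: ν
  set S3 := (S1.eu1 N).mid1 with hS3
  have hS3g : S3.g = s.fr.g := hgcd
  have hS3a : S3.a = s.fr.a := R1.a
  have E2 : EuRel S3 ((invStep s.fr.a1)^[N] (s.fr.a1, s.fr.b1, 0, 1 % s.fr.a1)) (S3.eu2 N) := by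
    have e1 : S3.u = s.fr.a1 := by show (S1.eu1 N).a / (S1.eu1 N).u = _; rw [R1.a, hgcd]; rfl
    have e2 : S3.v = s.fr.b1 := by show (S1.eu1 N).b / (S1.eu1 N).u = _; rw [R1.b, hgcd]; rfl
    have e3 : S3.t = 1 % s.fr.a1 := by show 1 % ((S1.eu1 N).a / (S1.eu1 N).u) = _; rw [R1.a, hgcd]; rfl
    have h0 : EuRel S3 (s.fr.a1, s.fr.b1, 0, 1 % s.fr.a1) S3 := ⟨rfl, e1, e2, rfl, e3⟩
    refine h0.iterate (g := fun X => X.a / X.g) (fun X hX => ?_) N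
    have ea : X.a = S3.a := (congrArg MS.a hX :)
    have eg : X.g = S3.g := (congrArg MS.g hX :)
    show X.a / X.g = s.fr.a1
    rw [ea, eg, hS3g, hS3a]; rfl
  have hnu : (S3.eu2 N).w = (sqData (pmOf d r m) s.fr N).1.2 := by rw [E2.w]; rfl
  have R2 : Rel d r m s (S3.eu2 N) := R1.mid1.of_euFrame E2.frame
  have hg2 : (S3.eu2 N).g = s.fr.g := by
    have e : (S3.eu2 N).g = S3.g := (congrArg MS.g E2.frame :)
    exact e.trans hS3g
  -- loop 3: λ
  set S5 := (S3.eu2 N).mid2 with hS5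
  have hS5g : S5.g = s.fr.g := hg2
  have E3 : EuRel S5 ((invStep s.fr.g)^[N] (s.fr.g, s.fr.c (disc d), 0, 1 % s.fr.g)) (S5.eu3 N) := by
    have e2 : S5.v = s.fr.c (disc d) := by
      show cZ (S3.eu2 N).d (S3.eu2 N).a (S3.eu2 N).b = _
      rw [R2.hd, R2.a, R2.b]; exact cZ_eq d _ _ s.fr.p s.fr.r
    have e3 : S5.t = 1 % s.fr.g := by show 1 % (S3.eu2 N).g = _; rw [hg2]
    have h0 : EuRel S5 (s.fr.g, s.fr.c (disc d), 0, 1 % s.fr.g) S5 := ⟨rfl, hg2, e2, rfl, e3⟩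
    refine h0.iterate (g := fun X => X.g) (fun X hX => ?_) N
    have e : X.g = S5.g := (congrArg MS.g hX :)
    exact e.trans hS5g
  have R3 : Rel d r m s (S5.eu3 N) := R2.mid2.of_euFrame E3.frame
  have hg3 : (S5.eu3 N).g = s.fr.g := by
    have e : (S5.eu3 N).g = S5.g := (congrArg MS.g E3.frame :)
    exact e.trans hS5g
  have hnu3 : (S5.eu3 N).nu = (sqData (pmOf d r m) s.fr N).1.2 := by
    have e : (S5.eu3 N).nu = S5.nu := (congrArg MS.nu E3.frame :)
    exact e.trans hnu
  exact ⟨E1.frame, hgcd, E2.frame, hnu, E3.frame, ⟨R3, hg3, hnu3, by rw [E3.w]; rfl⟩⟩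

/-! ### Register bounds -/

/-- All registers are below `2^w` in absolute value. [folklore] -/
def Sm (w : ℕ) (S : MS) : Prop := ∀ z ∈ S.lay, z.natAbs < 2 ^ w

/-- Smallness is monotone in the width. [folklore] -/
theorem Sm.mono {w w' : ℕ} {S : MS} (h : Sm w S) (hw : w ≤ w') : Sm w' S := fun z hz =>
  lt_of_lt_of_le (h z hz) (Nat.pow_le_pow_right (by norm_num) hw)

/-- `|z| < 2^w` in `ℤ` gives `natAbs z < 2^w`. [folklore] -/
theorem natAbs_lt_two_pow {z : ℤ} {w : ℕ} (h : |z| < (2 : ℤ) ^ w) : z.natAbs < 2 ^ w := by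
  have : ((z.natAbs : ℕ) : ℤ) < ((2 ^ w : ℕ) : ℤ) := by rw [Int.natCast_natAbs]; exact_mod_cast h
  exact_mod_cast this

/-- A register file is small when each of its 25 registers is. [folklore] -/
theorem sm_intro {w : ℕ} {S : MS} (h0 : |S.d| < (2:ℤ) ^ w) (h1 : |S.r| < (2:ℤ) ^ w) (h2 : |S.m| < (2:ℤ) ^ w)
    (h3 : |S.a| < (2:ℤ) ^ w) (h4 : |S.b| < (2:ℤ) ^ w) (h5 : |S.p1| < (2:ℤ) ^ w) (h6 : |S.p2| < (2:ℤ) ^ w)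
    (h7 : |S.r1| < (2:ℤ) ^ w) (h8 : |S.r2| < (2:ℤ) ^ w) (h9 : |S.sgn| < (2:ℤ) ^ w) (h10 : |S.M| < (2:ℤ) ^ w)
    (h11 : |S.E| < (2:ℤ) ^ w) (h12 : |S.i| < (2:ℤ) ^ w) (h13 : |S.acc| < (2:ℤ) ^ w) (h14 : |S.rr| < (2:ℤ) ^ w)
    (h15 : |S.k0| < (2:ℤ) ^ w) (h16 : |S.g| < (2:ℤ) ^ w) (h17 : |S.nu| < (2:ℤ) ^ w) (h18 : |S.lam| < (2:ℤ) ^ w)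
    (h19 : |S.u| < (2:ℤ) ^ w) (h20 : |S.v| < (2:ℤ) ^ w) (h21 : |S.w| < (2:ℤ) ^ w) (h22 : |S.t| < (2:ℤ) ^ w)
    (h23 : |S.ox| < (2:ℤ) ^ w) (h24 : |S.oy| < (2:ℤ) ^ w) : Sm w S := by
  intro z hz
  simp only [MS.lay, List.mem_cons, List.not_mem_nil, or_false] at hz
  apply natAbs_lt_two_pow
  rcases hz with rfl | rfl | rfl | rfl | rfl | rfl | rfl | rfl | rfl | rfl | rfl | rfl | rfl | rfl | rfl | rfl |
    rfl | rfl | rfl | rfl | rfl | rfl | rfl | rfl | rfl <;> assumption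

/-- The register width of the analysis: `w = 13n + 67`. [folklore] -/
def wOf (n : ℕ) : ℕ := 13 * n + 67

/-- Bounds of an abstract state sufficient for the register bounds. [folklore] -/
structure ASB (n Δ : ℕ) (s : AS) : Prop where
  a1 : 1 ≤ s.fr.a
  aΔ : s.fr.a ≤ Δ
  b : |s.fr.b| ≤ Δ + 2 * (Δ : ℤ) ^ 2
  sgn : s.sgn = 1 ∨ s.sgn = -1
  M0 : 0 ≤ s.M
  M : s.M < 2 ^ (3 * n + 17)
  E : |s.E| < 2 ^ (5 * n + 28)

/-- Bounds of the bookkeeping and Euclid registers. [folklore] -/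
structure BookB (n Δ : ℕ) (S : MS) : Prop where
  i : |S.i| ≤ 3 * n + 12
  acc0 : 0 ≤ S.acc
  acc : S.acc < 2 ^ (4 * n + 24)
  rr : |S.rr| < 2 ^ (3 * n + 12)
  k0 : |S.k0| ≤ 3 * n + 12
  g : |S.g| ≤ Δ
  nu : |S.nu| ≤ Δ
  lam : S.lam = 0
  u : |S.u| ≤ Δ
  v : |S.v| ≤ Δ
  w : |S.w| ≤ Δ
  t : |S.t| ≤ Δ
  ox : S.ox = 0
  oy : S.oy = 0

/-- `k < 2^k`, `k ≤ 2^k` in `ℤ`. [folklore] -/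
theorem natCast_lt_two_pow (k : ℕ) : (k : ℤ) < 2 ^ k := by exact_mod_cast Nat.lt_two_pow_self

/-- `Δ + 2Δ² < 2^{2n+2}` when `Δ < 2^n`. [folklore] -/
theorem b_bound_aux {Δ : ℤ} {n : ℕ} (h0 : 0 ≤ Δ) (hΔ : Δ < 2 ^ n) : Δ + 2 * Δ ^ 2 < 2 ^ (2 * n + 2) := by
  have : (2 : ℤ) ^ (2 * n + 2) = (2 ^ n) ^ 2 * 4 := by ring
  rw [this]; nlinarith

/-- **Related states with bounded abstract state and bookkeeping are small.** [folklore] -/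
theorem sm_of_rel (h : Rel d r m s S) (hB : ASB (nOf d r m) (disc d) s) (hK : BookB (nOf d r m) (disc d) S)
    (hm : 1 ≤ m) : Sm (wOf (nOf d r m)) S := by
  set n := nOf d r m with hn
  obtain ⟨hΔ, _⟩ := disc_lt_two_pow d r m
  rw [← hn] at hΔ
  have hΔ' : ((disc d : ℕ) : ℤ) < 2 ^ n := by exact_mod_cast hΔ
  have hdΔ : d ≤ disc d := by unfold disc; split_ifs <;> omega
  have hrn : (r : ℤ) < 2 ^ n := by
    have h1 : r < 2 ^ Nat.size r := Nat.lt_size_self r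
    have h2 : 2 ^ Nat.size r ≤ 2 ^ n := Nat.pow_le_pow_right (by norm_num) (by rw [hn]; unfold nOf; omega)
    exact_mod_cast h1.trans_le h2
  have hmn : (m : ℤ) < 2 ^ n := by
    have h1 : m < 2 ^ Nat.size m := Nat.lt_size_self m
    have h2 : 2 ^ Nat.size m ≤ 2 ^ n := Nat.pow_le_pow_right (by norm_num) (by rw [hn]; unfold nOf; omega)
    exact_mod_cast h1.trans_le h2
  have hw : ∀ k, k ≤ wOf n → (2 : ℤ) ^ k ≤ 2 ^ wOf n := fun k hk => pow_le_pow_right₀ (by norm_num) hk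
  have hn4 : 4 ≤ n := by rw [hn]; unfold nOf; omega
  have hwn := hw n (by unfold wOf; omega)
  have hmod : ∀ x : ℤ, |x % (m : ℕ)| < 2 ^ wOf n := fun x => by
    rw [abs_of_nonneg (Int.emod_nonneg _ (by positivity))]
    exact (Int.emod_lt_of_pos _ (by positivity)).trans_le ((hmn.le).trans hwn)
  have hsmall : ∀ x : ℤ, |x| ≤ disc d → |x| < 2 ^ wOf n := fun x hx => lt_of_le_of_lt hx (hΔ'.trans_le hwn)
  refine sm_intro ?_ ?_ ?_ ?_ ?_ ?_ ?_ ?_ ?_ ?_ ?_ ?_ ?_ ?_ ?_ ?_ ?_ ?_ ?_ ?_ ?_ ?_ ?_ ?_ ?_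
  · rw [h.hd, abs_of_nonneg (Int.natCast_nonneg d)]
    exact lt_of_le_of_lt (by exact_mod_cast hdΔ) (hΔ'.trans_le hwn)
  · rw [h.hr, abs_of_nonneg (Int.natCast_nonneg r)]; exact hrn.trans_le hwn
  · rw [h.hm, abs_of_nonneg (Int.natCast_nonneg m)]; exact hmn.trans_le hwn
  · rw [h.a, abs_of_nonneg (Int.natCast_nonneg _)]
    exact lt_of_le_of_lt (by exact_mod_cast hB.aΔ) (hΔ'.trans_le hwn)
  · rw [h.b]
    exact lt_of_le_of_lt hB.b ((b_bound_aux (Int.natCast_nonneg _) hΔ').trans_le (hw (2 * n + 2) (by unfold wOf; omega)))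
  · rw [h.p1]; exact hmod _
  · rw [h.p2]; exact hmod _
  · rw [h.r1]; exact hmod _
  · rw [h.r2]; exact hmod _
  · rw [h.sgn]; rcases hB.sgn with e | e <;> rw [e] <;> simp <;> exact one_lt_pow₀ (by norm_num) (by unfold wOf; omega)
  · rw [h.M, abs_of_nonneg hB.M0]; exact hB.M.trans_le (hw _ (by unfold wOf; omega))
  · rw [h.E]; exact hB.E.trans_le (hw _ (by unfold wOf; omega))
  · exact lt_of_le_of_lt hK.i ((natCast_lt_two_pow (3 * n + 12)).trans_le (by exact_mod_cast hw _ (by unfold wOf; omega)))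
  · rw [abs_of_nonneg hK.acc0]; exact hK.acc.trans_le (hw _ (by unfold wOf; omega))
  · exact hK.rr.trans_le (hw _ (by unfold wOf; omega))
  · exact lt_of_le_of_lt hK.k0 ((natCast_lt_two_pow (3 * n + 12)).trans_le (by exact_mod_cast hw _ (by unfold wOf; omega)))
  · exact hsmall _ hK.g
  · exact hsmall _ hK.nu
  · rw [hK.lam]; simp
  · exact hsmall _ hK.u
  · exact hsmall _ hK.v
  · exact hsmall _ hK.w
  · exact hsmall _ hK.t
  · rw [hK.ox]; simp
  · rw [hK.oy]; simp

/-- `w ≤ N` when `64 n ≤ N`. [folklore] -/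
theorem wOf_le (hN : 64 * nOf d r m ≤ N) : wOf (nOf d r m) ≤ N := by
  have : 4 ≤ nOf d r m := by unfold nOf; omega
  unfold wOf; omega

/-! ### Clamped loops along a predicate -/

/-- **Indexed loop simulation**: a round-indexed predicate under which the body program computes the
body function, which the body function carries to the next round, and which keeps the registers
below `2ᴺ`, makes the clamped loop the `N`-th iterate of the body function. [cite: AroraBarak2009, §1.3] -/
theorem run_loop_of {N : ℕ} {body : Prog} {F : MS → MS} {Q : ℕ → MS → Prop}
    (hrun : ∀ k S, k < N → Q k S → body.run N S.lay = (F S).lay)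
    (hQ : ∀ k S, k < N → Q k S → Q (k + 1) (F S)) (hB : ∀ k S, k < N → Q k S → Sm N (F S)) {S : MS}
    (h0 : Q 0 S) : (Prog.loop body).run N S.lay = (F^[N] S).lay ∧ Q N (F^[N] S) := by
  rw [run_loop]
  suffices h : ∀ k, k ≤ N → (fun l => clampAll N (body.run N l))^[k] S.lay = (F^[k] S).lay ∧ Q k (F^[k] S) from
    h N le_rfl
  intro k
  induction k with
  | zero => exact fun _ => ⟨rfl, h0⟩
  | succ k ih =>
    intro hk
    obtain ⟨e, hq⟩ := ih (by omega)
    rw [Function.iterate_succ_apply', Function.iterate_succ_apply', e, hrun k _ (by omega) hq,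
      clampAll_of_forall (hB k _ (by omega) hq)]
    exact ⟨rfl, hQ k _ (by omega) hq⟩

/-! ### The exponent schedule -/

/-- Per-step exponent increment, as a function of `n`: `C₂ ≤ 24n + 125`. [folklore] -/
def C2n (n : ℕ) : ℕ := 24 * n + 125
/-- Squaring exponent increment: `C₃ ≤ 14n + 73`. [folklore] -/
def C3n (n : ℕ) : ℕ := 14 * n + 73
/-- Per-level additive exponent growth `D = C₃ + 2 N C₂`. [folklore] -/
def Dn (n N : ℕ) : ℕ := C3n n + 2 * N * C2n n
/-- Exponent bound after phase A: `P + N C₂`. [folklore] -/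
def A0 (n N : ℕ) : ℕ := 3 * n + 16 + N * C2n n
/-- Exponent bound at the entry of level `j`: `2^j (A₀ + D) - D`. [folklore] -/
def EBz (n N j : ℕ) : ℤ := 2 ^ j * ((A0 n N : ℤ) + Dn n N) - Dn n N

/-- `C₂ ≤ 24n + 125` for the run parameters. [folklore] -/
theorem C2_le (d r m : ℕ) : (pmOf d r m).C2 ≤ C2n (nOf d r m) := by
  have := size_disc_le d r m
  unfold Prm.C2 C2n; simp only [pmOf_Δ, pmOf_q, pmOf_P]; omega

/-- `C₃ ≤ 14n + 73` for the run parameters. [folklore] -/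
theorem C3_le (d r m : ℕ) : (pmOf d r m).C3 ≤ C3n (nOf d r m) := by
  have := size_disc_le d r m
  unfold Prm.C3 C3n; simp only [pmOf_Δ, pmOf_P]; omega

/-- `EB₀ = A₀`. [folklore] -/
theorem EBz_zero (n N : ℕ) : EBz n N 0 = A0 n N := by unfold EBz; ring
/-- `EB_{j+1} = 2 EB_j + D`. [folklore] -/
theorem EBz_succ (n N j : ℕ) : EBz n N (j + 1) = 2 * EBz n N j + Dn n N := by unfold EBz; ring
/-- `A₀ ≤ EB_j`. [folklore] -/
theorem A0_le_EBz (n N j : ℕ) : (A0 n N : ℤ) ≤ EBz n N j := by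
  unfold EBz
  have h1 : (1 : ℤ) ≤ 2 ^ j := one_le_pow₀ (by norm_num)
  have h0 : (0 : ℤ) ≤ A0 n N := by positivity
  have hD : (0 : ℤ) ≤ Dn n N := by positivity
  nlinarith
/-- `EB_j` is monotone in `j`. [folklore] -/
theorem EBz_mono (n N : ℕ) {j j' : ℕ} (h : j ≤ j') : EBz n N j ≤ EBz n N j' := by
  unfold EBz
  have : (2 : ℤ) ^ j ≤ 2 ^ j' := pow_le_pow_right₀ (by norm_num) h
  have h0 : (0 : ℤ) ≤ (A0 n N : ℤ) + Dn n N := by positivity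
  nlinarith

/-- **The master inequality**: `EB_j < 2^{5n+28}` for `j ≤ 3n + 12`, `N ≤ 128 n`, `n ≥ 4`. [folklore] -/
theorem EBz_lt {n N j : ℕ} (hn : 4 ≤ n) (hN : N ≤ 128 * n) (hj : j ≤ 3 * n + 12) : EBz n N j < 2 ^ (5 * n + 28) := by
  have h4 : (4 : ℤ) ≤ n := by exact_mod_cast hn
  have hNz : (N : ℤ) ≤ 128 * n := by exact_mod_cast hN
  have hX : (A0 n N : ℤ) + Dn n N ≤ 65535 * (n : ℤ) ^ 2 := by
    have h1 : (N : ℤ) * (24 * n + 125) ≤ 128 * n * (24 * n + 125) := by nlinarith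
    unfold A0 Dn C2n C3n; push_cast; nlinarith
  have hsq : (n : ℤ) ^ 2 < 2 ^ (2 * n) := by
    have h := natCast_lt_two_pow n
    have h0 : (0 : ℤ) ≤ n := by positivity
    have h2 := pow_pos (show (0 : ℤ) < 2 by norm_num) n
    calc (n : ℤ) ^ 2 = n * n := pow_two _
      _ < 2 ^ n * 2 ^ n := by nlinarith
      _ = 2 ^ (2 * n) := by rw [← pow_add, two_mul]
  have hD : (0 : ℤ) ≤ Dn n N := by positivity
  have hAD : (0 : ℤ) ≤ (A0 n N : ℤ) + Dn n N := by positivity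
  have hj' : (2 : ℤ) ^ j ≤ 2 ^ (3 * n + 12) := pow_le_pow_right₀ (by norm_num) hj
  have hp := pow_pos (show (0 : ℤ) < 2 by norm_num) (3 * n + 12)
  have hp2 := pow_pos (show (0 : ℤ) < 2 by norm_num) (2 * n)
  calc EBz n N j = 2 ^ j * ((A0 n N : ℤ) + Dn n N) - Dn n N := rfl
    _ ≤ 2 ^ (3 * n + 12) * ((A0 n N : ℤ) + Dn n N) := by nlinarith
    _ ≤ 2 ^ (3 * n + 12) * (65535 * (n : ℤ) ^ 2) := by gcongr
    _ < 2 ^ (3 * n + 12) * (2 ^ 16 * 2 ^ (2 * n)) := by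
        apply mul_lt_mul_of_pos_left _ hp
        nlinarith
    _ = 2 ^ (5 * n + 28) := by rw [← pow_add, ← pow_add]; ring_nf

/-! ### Abstract bounds from the invariants -/

/-- A normalised mantissa is in `[0, 2^{P+1})`. [folklore] -/
theorem IsNorm.bounds {P : ℕ} {M : ℤ} (h : IsNorm P M) : 0 ≤ M ∧ M < 2 ^ (P + 1) :=
  ⟨le_trans (by positivity) h.1, h.2⟩

/-- A good (reduced) state with bounded exponent is bounded. [folklore] -/
theorem asb_of_good (hpm : (pmOf d r m).OK) {ε : ℝ} (hg : Good (pmOf d r m) s ε)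
    (hE : |s.E| < 2 ^ (5 * nOf d r m + 28)) : ASB (nOf d r m) (disc d) s := by
  obtain ⟨haΔ, hb⟩ := Red.frame_bounds (Δ := disc d) hpm.disc hg.red
  obtain ⟨hM0, hM⟩ := hg.acc.1.bounds
  refine ⟨hg.inv.1, haΔ, hb.trans ?_, hg.sgn, hM0, by simpa using hM, hE⟩
  nlinarith

/-- A normalised state of the reduction with bounded exponent is bounded. [folklore] -/
theorem asb_of_goodI {ε : ℝ} (hg : GoodI (pmOf d r m) s ε) (hN : Norm (disc d) s.fr)
    (ha : (s.fr.a : ℤ) < disc d) (hE : |s.E| < 2 ^ (5 * nOf d r m + 28)) : ASB (nOf d r m) (disc d) s := by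
  have hb := Norm.abs_b_le hN ha.le
  obtain ⟨hM0, hM⟩ := hg.acc.1.bounds
  refine ⟨hg.inv.1, by exact_mod_cast ha.le, hb.trans ?_, hg.sgn, hM0, by simpa using hM, hE⟩
  nlinarith

/-- A reduced frame with the float of a bounded state is bounded. [folklore] -/
theorem asb_of_inv_red (hpm : (pmOf d r m).OK) (hI : Inv (disc d) s.fr) (hR : Red (disc d) s.fr)
    {s' : AS} (hs' : ASB (nOf d r m) (disc d) s') (hM : s.M = s'.M) (hE : s.E = s'.E) (hsgn : s.sgn = s'.sgn) :
    ASB (nOf d r m) (disc d) s := by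
  obtain ⟨haΔ, hb⟩ := Red.frame_bounds (Δ := disc d) hpm.disc hR
  refine ⟨hI.1, haΔ, hb.trans (by nlinarith), by rw [hsgn]; exact hs'.sgn, by rw [hM]; exact hs'.M0,
    by rw [hM]; exact hs'.M, by rw [hE]; exact hs'.E⟩

/-! ### Bookkeeping bounds -/

/-- The partial sums of `ln2K` are in `[0, i 2^K]`. [folklore] -/
theorem ln2P_bounds (K i : ℕ) : 0 ≤ ln2P K i ∧ ln2P K i ≤ i * 2 ^ K := by
  induction i with
  | zero => simp [ln2P]
  | succ i ih =>
    have ht : 0 ≤ (2 : ℤ) ^ K / ((i + 1) * 2 ^ (i + 1)) ∧ (2 : ℤ) ^ K / ((i + 1) * 2 ^ (i + 1)) ≤ 2 ^ K :=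
      ⟨Int.ediv_nonneg (by positivity) (by positivity), Int.ediv_le_self _ (by positivity)⟩
    unfold ln2P at ih ⊢
    rw [Finset.sum_range_succ]
    push_cast
    constructor <;> nlinarith [ih.1, ih.2, ht.1, ht.2]

/-- The partial sums of `ln2K` are `< 2^{4n+24}`. [folklore] -/
theorem ln2P_lt (n : ℕ) (i : ℕ) (hi : i ≤ 2 * n + 12) : ln2P (2 * n + 12) i < 2 ^ (4 * n + 24) := by
  obtain ⟨_, h⟩ := ln2P_bounds (2 * n + 12) i
  have hK : ((2 * n + 12 : ℕ) : ℤ) < 2 ^ (2 * n + 12) := natCast_lt_two_pow _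
  calc ln2P (2 * n + 12) i ≤ i * 2 ^ (2 * n + 12) := h
    _ ≤ (2 * n + 12 : ℕ) * 2 ^ (2 * n + 12) := by gcongr
    _ < 2 ^ (2 * n + 12) * 2 ^ (2 * n + 12) := mul_lt_mul_of_pos_right hK (by positivity)
    _ = 2 ^ (4 * n + 24) := by rw [← pow_add]; ring_nf

/-- `|r₂| < 2^{3n+12}` when `r < 2^n`. [folklore] -/
theorem abs_r2_lt (hr : r < 2 ^ nOf d r m) : |r2 r (2 * nOf d r m + 12)| < 2 ^ (3 * nOf d r m + 12) := by
  unfold r2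
  refine (Int.abs_ediv_le_abs _ _).trans_lt ?_
  have h0 : (0 : ℤ) ≤ (r : ℤ) * 2 ^ (2 * nOf d r m + 12) := by positivity
  have hr' : (r : ℤ) < ((2 ^ nOf d r m : ℕ) : ℤ) := Nat.cast_lt.mpr hr
  rw [Nat.cast_pow, Nat.cast_ofNat] at hr'
  calc |(r : ℤ) * 2 ^ (2 * nOf d r m + 12)| = r * 2 ^ (2 * nOf d r m + 12) := abs_of_nonneg h0
    _ < 2 ^ nOf d r m * 2 ^ (2 * nOf d r m + 12) := mul_lt_mul_of_pos_right hr' (pow_pos two_pos _)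
    _ = 2 ^ (3 * nOf d r m + 12) := by rw [← pow_add]; ring_nf

/-- `r < 2^n`. [folklore] -/
theorem r_lt_two_pow (d r m : ℕ) : r < 2 ^ nOf d r m :=
  (Nat.lt_size_self r).trans_le (Nat.pow_le_pow_right (by norm_num) (by unfold nOf; omega))

/-- The `kz` iterates stay in `[0, l]`. [folklore] -/
theorem kz_iter_le (T : ℤ) (l : ℕ) (V : ℤ) (k : ℕ) :
    (fun k => if pref T l k < V ∧ k < l then k + 1 else k)^[k] 0 ≤ l := by
  induction k with
  | zero => exact Nat.zero_le _
  | succ k ih =>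
    rw [Function.iterate_succ_apply']
    split_ifs with h
    · omega
    · exact ih

/-! ### Goodness and exponents along the run (abstract) -/

section Abstract

variable {pm : Prm}

/-- Guarded walks keep good states good. [folklore] -/
theorem good_gstep_iter (h : pm.OK) {s : AS} {ε : ℝ} (hg : Good pm s ε) (tgt : ℤ) (k : ℕ) :
    ∃ ε', Good pm ((gstep pm tgt)^[k] s) ε' := by
  obtain ⟨j, _, e⟩ := gstep_iterate_exists (pm := pm) tgt s k
  rw [e]; exact ⟨_, hg.bstepF_iterate h j⟩

/-- The exponent after a baby step with floats. [folklore] -/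
theorem abs_bstepF_E (h : pm.OK) {s : AS} {ε : ℝ} (hg : Good pm s ε) : |(bstepF pm s).E| ≤ |s.E| + pm.C2 := by
  obtain ⟨haΔ, hb⟩ := Red.frame_bounds h.disc hg.red
  exact h.abs_mulFac_snd_le hg.inv.1 haΔ hb

/-- The exponent along a guarded walk grows by at most `C₂` per round. [folklore] -/
theorem abs_gstep_iter_E (h : pm.OK) {s : AS} {ε : ℝ} (hg : Good pm s ε) (tgt : ℤ) (k : ℕ) :
    |((gstep pm tgt)^[k] s).E| ≤ |s.E| + k * pm.C2 := by
  induction k with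
  | zero => simp
  | succ k ih =>
    obtain ⟨ε', hg'⟩ := good_gstep_iter h hg tgt k
    rw [Function.iterate_succ_apply']
    set t := (gstep pm tgt)^[k] s with ht
    show |(gstep pm tgt t).E| ≤ _
    unfold gstep
    by_cases hc : ilog pm t < tgt
    · rw [if_pos hc]; have := abs_bstepF_E h hg'; push_cast; linarith
    · rw [if_neg hc]; push_cast; linarith [show (0 : ℤ) ≤ pm.C2 by positivity]

/-- The exponent after a reduction round. [folklore] -/
theorem abs_rstepF_E (h : pm.OK) {s : AS} {ε : ℝ} (hg : GoodI pm s ε) (hN : Norm pm.Δ s.fr)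
    (ha : (s.fr.a : ℤ) < pm.Δ) : |(rstepF pm s).E| ≤ |s.E| + pm.C2 := by
  unfold rstepF
  by_cases hred : RedTest pm.Δ s.fr
  · rw [if_pos hred]; linarith [show (0 : ℤ) ≤ pm.C2 by positivity]
  · rw [if_neg hred]
    exact h.abs_mulFac_snd_le hg.inv.1 (by exact_mod_cast ha.le) (Norm.abs_b_le hN ha.le)

/-- Along the reduction after a squaring: goodness, normalisation, `a < Δ`, and the exponent.
[cite: JacobsonWilliams2008, §5.4, §12.2] -/
theorem reduce_iter_spec (h : pm.OK) {s : AS} {ε : ℝ} (hg : Good pm s ε) {fuel : ℕ}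
    (hfuel : 2 * Nat.size pm.Δ + 2 ≤ fuel) (k : ℕ) :
    (∃ ε', GoodI pm (reduceF pm (sqF pm fuel s) k) ε') ∧ Norm pm.Δ (reduceF pm (sqF pm fuel s) k).fr ∧
      ((reduceF pm (sqF pm fuel s) k).fr.a : ℤ) < pm.Δ ∧
      |(reduceF pm (sqF pm fuel s) k).E| ≤ 2 * |s.E| + pm.C3 + k * pm.C2 := by
  obtain ⟨hGI, _, haΔ⟩ := hg.sqF_spec h hfuel
  obtain ⟨_, _, _, hg1, hgΔ, _⟩ := h.sq_frame_bounds hg fuel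
  have hsq := abs_sqF_E_le (pm := pm) (fuel := fuel) hg1 hgΔ
  refine ⟨⟨_, hGI.reduceF_goodI h haΔ k⟩, (redInv_reduceF h hGI.inv k).norm, h.reduceF_a_lt hGI.inv haΔ k, ?_⟩
  induction k with
  | zero => rw [reduceF_zero]; push_cast; linarith
  | succ k ih =>
    rw [reduceF_succ]
    have := abs_rstepF_E h (hGI.reduceF_goodI h haΔ k) (redInv_reduceF h hGI.inv k).norm (h.reduceF_a_lt hGI.inv haΔ k)
    push_cast; linarith

/-- The reduction after a squaring ends in a good state when the fuel is `≥ |Δ| + 1`. [folklore] -/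
theorem good_reduce_sq (h : pm.OK) {s : AS} {ε : ℝ} (hg : Good pm s ε) {fuel n : ℕ}
    (hfuel : 2 * Nat.size pm.Δ + 2 ≤ fuel) (hn : Nat.size pm.Δ + 1 ≤ n) :
    ∃ ε', Good pm (reduceF pm (sqF pm fuel s) n) ε' := by
  obtain ⟨hGI, _, haΔ⟩ := hg.sqF_spec h hfuel
  have hL : (sqF pm fuel s).fr.a < 4 ^ Nat.size pm.Δ := by
    have h1 : (sqF pm fuel s).fr.a < pm.Δ := by exact_mod_cast haΔ
    have h2 : pm.Δ < 2 ^ Nat.size pm.Δ := Nat.lt_size_self _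
    have h3 : 2 ^ Nat.size pm.Δ ≤ 4 ^ Nat.size pm.Δ := Nat.pow_le_pow_left (by norm_num) _
    omega
  exact ⟨_, (hGI.reduceF_spec h haΔ hL hn).1⟩

end Abstract

/-- The level data of a run. [folklore] -/
theorem lp_fields (d r m N : ℕ) (T : ℤ) :
    (lpOf d r m N T).pm = pmOf d r m ∧ (lpOf d r m N T).N = N ∧ (lpOf d r m N T).c₀ = 2 * nOf d r m + 8 ∧
      (lpOf d r m N T).T = T ∧ (lpOf d r m N T).l = Nat.size T.toNat - 1 ∧ (lpOf d r m N T).n = nOf d r m :=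
  ⟨rfl, rfl, rfl, rfl, rfl, rfl⟩

/-- **Goodness and the exponent schedule along the levels.** [cite: JacobsonWilliams2008, §12.2 (Alg. 12.6)] -/
theorem levels_spec' (hd : Squarefree d) (h2 : 2 ≤ d) (hN : 64 * nOf d r m ≤ N) (T : ℤ) (k₀ : ℕ) {s : AS}
    {ε : ℝ} (hg : Good (pmOf d r m) s ε) (hE : |s.E| ≤ A0 (nOf d r m) N) (j : ℕ) :
    (∃ ε', Good (pmOf d r m) (levels (lpOf d r m N T) k₀ j s) ε') ∧
      |(levels (lpOf d r m N T) k₀ j s).E| ≤ EBz (nOf d r m) N j := by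
  have hpm : (pmOf d r m).OK := pmOf_OK hd h2
  obtain ⟨_, hsΔ, _⟩ := caps d r m hN
  have hfuel : 2 * Nat.size (pmOf d r m).Δ + 2 ≤ N := by simp only [pmOf_Δ]; omega
  have hn1 : Nat.size (pmOf d r m).Δ + 1 ≤ N := by simp only [pmOf_Δ]; omega
  have hC2 := C2_le d r m
  have hC3 := C3_le d r m
  induction j with
  | zero => exact ⟨⟨ε, hg⟩, by rw [EBz_zero]; exact hE⟩
  | succ j ih =>
    obtain ⟨⟨ε', hg'⟩, hE'⟩ := ih
    show (∃ ε'', Good (pmOf d r m) (level (lpOf d r m N T) (k₀ + j + 1) (levels (lpOf d r m N T) k₀ j s)) ε'') ∧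
      |(level (lpOf d r m N T) (k₀ + j + 1) (levels (lpOf d r m N T) k₀ j s)).E| ≤ EBz (nOf d r m) N (j + 1)
    unfold level
    simp only [(lp_fields d r m N T).1, (lp_fields d r m N T).2.1]
    obtain ⟨ε'', hg''⟩ := good_reduce_sq hpm hg' hfuel hn1
    refine ⟨good_gstep_iter hpm hg'' _ N, ?_⟩
    have h1 := abs_gstep_iter_E hpm hg'' (pref (lpOf d r m N T).T (lpOf d r m N T).l (k₀ + j + 1) -
      (lpOf d r m N T).c₀) N
    obtain ⟨_, _, _, h2⟩ := reduce_iter_spec hpm hg' hfuel N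
    rw [EBz_succ]
    unfold gwalk Dn
    have hC2' : ((pmOf d r m).C2 : ℤ) ≤ C2n (nOf d r m) := by exact_mod_cast hC2
    have hC3' : ((pmOf d r m).C3 : ℤ) ≤ C3n (nOf d r m) := by exact_mod_cast hC3
    have hN0 : (0 : ℤ) ≤ N := by positivity
    push_cast
    nlinarith

/-! ### Zeroed scratch registers and bookkeeping -/

/-- The scratch registers are zero (outside the Euclid loops). [folklore] -/
structure Zr (S : MS) : Prop where
  g : S.g = 0
  nu : S.nu = 0
  lam : S.lam = 0
  u : S.u = 0
  v : S.v = 0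
  w : S.w = 0
  t : S.t = 0
  ox : S.ox = 0
  oy : S.oy = 0

/-- The scratch registers stay zero under `bstepM`. [folklore] -/
theorem Zr.bstepM (h : Zr S) : Zr S.bstepM := ⟨h.g, h.nu, h.lam, rfl, rfl, rfl, h.t, h.ox, h.oy⟩
/-- The scratch registers stay zero under `mulFacM`. [folklore] -/
theorem Zr.mulFacM (h : Zr S) : Zr (S.mulFacM N) := ⟨h.g, h.nu, h.lam, h.u, rfl, rfl, rfl, h.ox, h.oy⟩
/-- The scratch registers stay zero under `gstepM`. [folklore] -/
theorem Zr.gstepM (h : Zr S) : Zr (S.gstepM N) := by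
  unfold MS.gstepM; split_ifs; exacts [h.mulFacM.bstepM, h]
/-- The scratch registers stay zero under `sgnM`. [folklore] -/
theorem Zr.sgnM (h : Zr S) : Zr S.sgnM := ⟨h.g, h.nu, h.lam, h.u, h.v, h.w, h.t, h.ox, h.oy⟩
/-- The scratch registers stay zero under `pstepM`. [folklore] -/
theorem Zr.pstepM (h : Zr S) : Zr S.pstepM := ⟨h.g, h.nu, h.lam, rfl, h.v, h.w, rfl, h.ox, h.oy⟩
/-- The scratch registers stay zero under `normM`. [folklore] -/
theorem Zr.normM (h : Zr S) : Zr S.normM := ⟨h.g, h.nu, h.lam, rfl, rfl, h.w, h.t, h.ox, h.oy⟩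
/-- The scratch registers stay zero under `rstepM`. [folklore] -/
theorem Zr.rstepM (h : Zr S) : Zr (S.rstepM N) := by
  unfold MS.rstepM; split_ifs; exacts [h, h.mulFacM.sgnM.pstepM.normM]
/-- The scratch registers stay zero under `finM`. [folklore] -/
theorem Zr.finM (h : Zr S) : Zr S.finM := by
  unfold MS.finM; split_ifs; exacts [h, h.bstepM]
/-- The scratch registers stay zero under `kzM`. [folklore] -/
theorem Zr.kzM (h : Zr S) : Zr (S.kzM N) := ⟨h.g, h.nu, h.lam, h.u, h.v, h.w, h.t, h.ox, h.oy⟩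
/-- The scratch registers stay zero under `initM`. [folklore] -/
theorem Zr.initM (h : Zr S) : Zr (S.initM N) := ⟨h.g, h.nu, h.lam, h.u, h.v, h.w, h.t, h.ox, h.oy⟩
/-- The scratch registers stay zero under `sqPostM`. [folklore] -/
theorem Zr.sqPostM (S : MS) (hox : S.ox = 0) (hoy : S.oy = 0) : Zr (S.sqPostM N) :=
  ⟨rfl, rfl, rfl, rfl, rfl, rfl, rfl, hox, hoy⟩
/-- The initial register file has zero scratch registers. [folklore] -/
theorem zr_init (d r m : ℕ) : Zr (MS.init d r m) := ⟨rfl, rfl, rfl, rfl, rfl, rfl, rfl, rfl, rfl⟩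

/-- A guarded baby step keeps the bookkeeping registers. [folklore] -/
theorem gstepM_book (S : MS) : (S.gstepM N).book = S.book := by
  unfold MS.gstepM MS.book; split_ifs <;> rfl
/-- A reduction round keeps the bookkeeping registers. [folklore] -/
theorem rstepM_book (S : MS) : (S.rstepM N).book = S.book := by
  unfold MS.rstepM MS.book; split_ifs <;> rfl
/-- A final-walk round keeps the bookkeeping registers. [folklore] -/
theorem finM_book (S : MS) : S.finM.book = S.book := by
  unfold MS.finM MS.book; split_ifs <;> rfl

/-- The bookkeeping bounds from the bookkeeping values and zero scratch. [folklore] -/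
theorem bookB_of {k₀ i : ℕ} (hbook : S.book = (r2 r (2 * nOf d r m + 12), (k₀ : ℤ), (i : ℤ), ln2K (2 * nOf d r m + 12)))
    (hk : k₀ ≤ 3 * nOf d r m + 12) (hi : i ≤ 3 * nOf d r m + 12) (hz : Zr S) : BookB (nOf d r m) (disc d) S := by
  simp only [MS.book, Prod.mk.injEq] at hbook
  obtain ⟨e1, e2, e3, e4⟩ := hbook
  obtain ⟨hacc0, _⟩ := ln2P_bounds (2 * nOf d r m + 12) (2 * nOf d r m + 12)
  refine ⟨?_, ?_, ?_, ?_, ?_, ?_, ?_, hz.lam, ?_, ?_, ?_, ?_, hz.ox, hz.oy⟩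
  · rw [show S.i = i from e3, abs_of_nonneg (Int.natCast_nonneg i)]; exact_mod_cast hi
  · rw [show S.acc = _ from e4, ← ln2P_K]; exact hacc0
  · rw [show S.acc = _ from e4, ← ln2P_K]; exact ln2P_lt _ _ le_rfl
  · rw [show S.rr = _ from e1]; exact abs_r2_lt (r_lt_two_pow d r m)
  · rw [show S.k0 = k₀ from e2, abs_of_nonneg (Int.natCast_nonneg k₀)]; exact_mod_cast hk
  · rw [hz.g]; simp
  · rw [hz.nu]; simp
  · rw [hz.u]; simp
  · rw [hz.v]; simp
  · rw [hz.w]; simp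
  · rw [hz.t]; simp

/-! ### The run hypotheses -/

/-- The hypotheses of a run: squarefree `d ≥ 2`, `m ≥ 1`, `64n ≤ N ≤ 128n`. [folklore] -/
structure RunCtx (d r m N : ℕ) : Prop where
  hd : Squarefree d
  h2 : 2 ≤ d
  hm : 1 ≤ m
  hN : 64 * nOf d r m ≤ N
  hN' : N ≤ 128 * nOf d r m

/-- The run parameters are admissible. [folklore] -/
theorem RunCtx.hpm (C : RunCtx d r m N) : (pmOf d r m).OK := pmOf_OK C.hd C.h2
/-- `n ≥ 4`. [folklore] -/
theorem RunCtx.n4 (C : RunCtx d r m N) : 4 ≤ nOf d r m := by have := C.hN; unfold nOf; omega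

/-! ### Phase: `ln2K` -/

/-- The register file with the inputs, `i`, `acc` and zeros. [folklore] -/
def MS.bare (d r m : ℕ) (i acc : ℤ) : MS := ⟨d, r, m, 0, 0, 0, 0, 0, 0, 0, 0, 0, i, acc, 0, 0, 0, 0, 0, 0, 0, 0, 0, 0, 0⟩

/-- The initial register file is `bare d r m 0 0`. [folklore] -/
theorem MS.init_eq_bare (d r m : ℕ) : MS.init d r m = MS.bare d r m 0 0 := rfl

/-- A register file with only inputs and bookkeeping `i, acc` set is small. [folklore] -/
theorem sm_bare (C : RunCtx d r m N) {i acc : ℤ} (hi : |i| ≤ 3 * nOf d r m + 12) (hacc0 : 0 ≤ acc)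
    (hacc : acc < 2 ^ (4 * nOf d r m + 24)) : Sm N (MS.bare d r m i acc) := by
  set n := nOf d r m with hn
  obtain ⟨hΔ, _⟩ := disc_lt_two_pow d r m
  have hΔ' : ((disc d : ℕ) : ℤ) < 2 ^ n := by exact_mod_cast hΔ
  have hdΔ : d ≤ disc d := by unfold disc; split_ifs <;> omega
  have hw : ∀ k, k ≤ wOf n → (2 : ℤ) ^ k ≤ 2 ^ wOf n := fun k hk => pow_le_pow_right₀ (by norm_num) hk
  have hwn := hw n (by unfold wOf; omega)
  have hrn : (r : ℤ) < 2 ^ n := by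
    have h1 : (r : ℤ) < ((2 ^ n : ℕ) : ℤ) := Nat.cast_lt.mpr (r_lt_two_pow d r m)
    rwa [Nat.cast_pow, Nat.cast_ofNat] at h1
  have hmn : (m : ℤ) < 2 ^ n := by
    have h1 : m < 2 ^ n := (Nat.lt_size_self m).trans_le (Nat.pow_le_pow_right (by norm_num) (by rw [hn]; unfold nOf; omega))
    have h2 : (m : ℤ) < ((2 ^ n : ℕ) : ℤ) := Nat.cast_lt.mpr h1
    rwa [Nat.cast_pow, Nat.cast_ofNat] at h2
  have h0 : abs (0 : ℤ) < (2 : ℤ) ^ wOf n := by rw [abs_zero]; exact pow_pos two_pos _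
  have e1 : |(d : ℤ)| < 2 ^ wOf n := by
    rw [abs_of_nonneg (Int.natCast_nonneg d)]
    exact lt_of_le_of_lt (by exact_mod_cast hdΔ) (hΔ'.trans_le hwn)
  have e2 : |(r : ℤ)| < 2 ^ wOf n := by rw [abs_of_nonneg (Int.natCast_nonneg r)]; exact hrn.trans_le hwn
  have e3 : |(m : ℤ)| < 2 ^ wOf n := by rw [abs_of_nonneg (Int.natCast_nonneg m)]; exact hmn.trans_le hwn
  have e4 : |i| < 2 ^ wOf n :=
    lt_of_le_of_lt hi ((natCast_lt_two_pow (3 * n + 12)).trans_le (by exact_mod_cast hw _ (by unfold wOf; omega)))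
  have e5 : |acc| < 2 ^ wOf n := by rw [abs_of_nonneg hacc0]; exact hacc.trans_le (hw _ (by unfold wOf; omega))
  have key : Sm (wOf n) (MS.bare d r m i acc) :=
    sm_intro e1 e2 e3 h0 h0 h0 h0 h0 h0 h0 h0 h0 e4 e5 h0 h0 h0 h0 h0 h0 h0 h0 h0 h0 h0
  exact key.mono (wOf_le C.hN)

/-- **The `ln2K` loop** computes `(i, acc) = (K, ln2K K)`. [folklore] -/
theorem run_ln2Loop (C : RunCtx d r m N) :
    (Prog.loop ln2Body).run N (MS.init d r m).lay =
      (MS.bare d r m ((2 * nOf d r m + 12 : ℕ) : ℤ) (ln2K (2 * nOf d r m + 12))).lay := by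
  set K := 2 * nOf d r m + 12 with hK
  have hKN : K ≤ N := by have := C.hN; have := C.n4; omega
  have hstep : ∀ k, (MS.bare d r m ((min k K : ℕ) : ℤ) (ln2P K (min k K))).ln2M N =
      MS.bare d r m ((min (k + 1) K : ℕ) : ℤ) (ln2P K (min (k + 1) K)) := fun k =>
    ln2M_spec (S := MS.bare d r m ((min k K : ℕ) : ℤ) (ln2P K (min k K))) (i := k) C.hN rfl rfl rfl rfl rfl
  have key := run_loop_of (N := N) (body := ln2Body) (F := MS.ln2M N)
    (Q := fun k X => X = MS.bare d r m ((min k K : ℕ) : ℤ) (ln2P K (min k K)))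
    (fun k X _ _ => run_ln2Body N X)
    (fun k X _ hX => by subst hX; exact hstep k)
    (fun k X _ hX => by
      subst hX
      rw [hstep k]
      obtain ⟨h0, _⟩ := ln2P_bounds K (min (k + 1) K)
      refine sm_bare C ?_ h0 (ln2P_lt _ _ (min_le_right _ _))
      rw [abs_of_nonneg (Int.natCast_nonneg _)]; exact_mod_cast (min_le_right _ _).trans (by omega))
    (S := MS.init d r m) (by rw [MS.init_eq_bare]; simp [ln2P])
  rw [key.1, key.2, min_eq_right hKN, ln2P_K]

/-! ### Phase: `kz` -/

/-- The machine quantity `book` agrees with the abstract parameter of the run. [folklore] -/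
theorem book_eq {S : MS} {a b c e : ℤ} (h : S.book = (a, b, c, e)) : S.rr = a ∧ S.k0 = b ∧ S.i = c ∧ S.acc = e := by
  simp only [MS.book, Prod.mk.injEq] at h; exact h

/-- Related states are carried to related states by `setK0`. [folklore] -/
theorem Rel.setK0 (h : Rel d r m s S) (k : ℤ) : Rel d r m s { S with k0 := k } :=
  ⟨h.hd, h.hr, h.hm, h.a, h.b, h.p1, h.p2, h.r1, h.r2, h.sgn, h.M, h.E⟩
/-- Related states are carried to related states by `setI`. [folklore] -/
theorem Rel.setI (h : Rel d r m s S) (k : ℤ) : Rel d r m s { S with i := k } :=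
  ⟨h.hd, h.hr, h.hm, h.a, h.b, h.p1, h.p2, h.r1, h.r2, h.sgn, h.M, h.E⟩
/-- The scratch registers stay zero under `setK0`. [folklore] -/
theorem Zr.setK0 (h : Zr S) (k : ℤ) : Zr { S with k0 := k } := ⟨h.g, h.nu, h.lam, h.u, h.v, h.w, h.t, h.ox, h.oy⟩
/-- The scratch registers stay zero under `setI`. [folklore] -/
theorem Zr.setI (h : Zr S) (k : ℤ) : Zr { S with i := k } := ⟨h.g, h.nu, h.lam, h.u, h.v, h.w, h.t, h.ox, h.oy⟩

/-- The target `T = r₂ - 4n` has `l ≤ 3n + 11`. [folklore] -/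
theorem l_le (d r m : ℕ) {T : ℤ} (hT : T = r2 r (2 * nOf d r m + 12) - 4 * nOf d r m) :
    Nat.size T.toNat - 1 ≤ 3 * nOf d r m + 11 := by
  have h := abs_r2_lt (d := d) (m := m) (r_lt_two_pow d r m)
  rw [abs_lt] at h
  have : T.toNat < 2 ^ (3 * nOf d r m + 12) := by
    have h1 : (T.toNat : ℤ) < 2 ^ (3 * nOf d r m + 12) := by
      rcases le_or_gt 0 T with h0 | h0
      · rw [Int.toNat_of_nonneg h0]; omega
      · rw [Int.toNat_eq_zero.mpr h0.le]; positivity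
    exact_mod_cast h1
  have := Nat.size_le.mpr this
  omega

/-- **The `kz` loop** computes `k₀`. [folklore] -/
theorem run_kzLoop (C : RunCtx d r m N) {S : MS} {s : AS} (hR : Rel d r m s S) (hA : ASB (nOf d r m) (disc d) s)
    {i : ℕ} (hbook : S.book = (r2 r (2 * nOf d r m + 12), ((0 : ℕ) : ℤ), (i : ℤ), ln2K (2 * nOf d r m + 12)))
    (hi : i ≤ 3 * nOf d r m + 12) (hz : Zr S) {T : ℤ} (hT : T = r2 r (2 * nOf d r m + 12) - 4 * nOf d r m)
    (hT1 : 1 ≤ T) :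
    (Prog.loop kzBody).run N S.lay =
      ({ S with k0 := (kz T (Nat.size T.toNat - 1) ((2 * nOf d r m + 8 : ℕ) + 1) N : ℤ) } : MS).lay := by
  set n := nOf d r m with hn
  set l := Nat.size T.toNat - 1 with hl
  set V : ℤ := (2 * n + 8 : ℕ) + 1 with hV
  set step : ℕ → ℕ := fun k => if pref T l k < V ∧ k < l then k + 1 else k with hstep
  obtain ⟨hrr, _, hi', hacc⟩ := book_eq hbook
  have hTZ : TZ d r m S.rr = T := by rw [TZ_eq, hrr, hT]
  have hl' := l_le d r m hT
  have hlN : l ≤ N := by have := C.hN; have := C.n4; omega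
  have hQstep : ∀ k : ℕ, ({ S with k0 := ((step^[k] 0 : ℕ) : ℤ) } : MS).kzM N =
      { S with k0 := ((step^[k + 1] 0 : ℕ) : ℤ) } := fun k => by
    have e := kzM_spec (S := { S with k0 := ((step^[k] 0 : ℕ) : ℤ) }) (d := d) (r := r) (m := m) (N := N)
      hR.hd hR.hr hR.hm hTZ hT1 hl hlN rfl
    rw [Function.iterate_succ_apply']
    show ({ S with k0 := _ } : MS) = _
    congr 1
  have key := run_loop_of (N := N) (body := kzBody) (F := MS.kzM N)
    (Q := fun k X => X = { S with k0 := ((step^[k] 0 : ℕ) : ℤ) })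
    (fun k X _ _ => run_kzBody N X)
    (fun k X _ hX => by subst hX; exact hQstep k)
    (fun k X _ hX => by
      subst hX; rw [hQstep k]
      refine (sm_of_rel (hR.setK0 _) hA (bookB_of (k₀ := step^[k + 1] 0) (i := i) ?_ ?_ hi (hz.setK0 _)) C.hm).mono
        (wOf_le C.hN)
      · show (S.rr, _, S.i, S.acc) = _; rw [hrr, hi', hacc]
      · exact (kz_iter_le T l V (k + 1)).trans (by omega))
    (S := S) (by cases S; simp only [MS.book, Prod.mk.injEq] at hbook; simp [hbook.2.1])
  rw [key.1, key.2]; rfl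

/-! ### Phase: guarded walks -/

/-- **A guarded-walk loop on related states.** [cite: JacobsonWilliams2008, §12.1] -/
theorem run_gstepLoop (C : RunCtx d r m N) {S : MS} {s : AS} {ε : ℝ} (hR : Rel d r m s S) (hg : Good (pmOf d r m) s ε)
    {k₀ i : ℕ} (hbook : S.book = (r2 r (2 * nOf d r m + 12), (k₀ : ℤ), (i : ℤ), ln2K (2 * nOf d r m + 12)))
    (hk₀ : k₀ ≤ 3 * nOf d r m + 12) (hi : i ≤ 3 * nOf d r m + 12) (hz : Zr S) {T : ℤ}
    (hT : T = r2 r (2 * nOf d r m + 12) - 4 * nOf d r m) (hT1 : 1 ≤ T)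
    (hE : ∀ k, k ≤ N → |((gstep (pmOf d r m) (pref T (Nat.size T.toNat - 1) (k₀ + i) - (2 * nOf d r m + 8 : ℕ)))^[k] s).E|
      < 2 ^ (5 * nOf d r m + 28)) :
    (Prog.loop gstepBody).run N S.lay = ((MS.gstepM N)^[N] S).lay ∧
      Rel d r m ((gstep (pmOf d r m) (pref T (Nat.size T.toNat - 1) (k₀ + i) - (2 * nOf d r m + 8 : ℕ)))^[N] s)
        ((MS.gstepM N)^[N] S) ∧
      ((MS.gstepM N)^[N] S).book = S.book ∧ Zr ((MS.gstepM N)^[N] S) := by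
  set pm := pmOf d r m with hpmdef
  set l := Nat.size T.toNat - 1 with hl
  set tgt := pref T l (k₀ + i) - (2 * nOf d r m + 8 : ℕ) with htgt
  have hpm : pm.OK := C.hpm
  have hl' := l_le d r m hT
  have hlN : l ≤ N := by have := C.hN; have := C.n4; omega
  have key := run_loop_of (N := N) (body := gstepBody) (F := MS.gstepM N)
    (Q := fun k X => Rel d r m ((gstep pm tgt)^[k] s) X ∧ X.book = S.book ∧ Zr X)
    (fun k X _ _ => run_gstepBody N X)
    (fun k X _ hX => by
      obtain ⟨hRX, hbX, hzX⟩ := hX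
      obtain ⟨hrr, hk0, hiX, _⟩ := book_eq (hbX.trans hbook)
      obtain ⟨ε', hg'⟩ := good_gstep_iter hpm hg tgt k
      have hTZ : TZ d r m X.rr = T := by rw [TZ_eq, hrr, hT]
      obtain ⟨h1, _⟩ := hRX.gstepM hpm C.hN hg'.inv hg'.red hTZ hT1 hl hlN hk0 hiX
      refine ⟨by rw [Function.iterate_succ_apply']; exact h1, (gstepM_book (N := N) X).trans hbX, hzX.gstepM⟩)
    (fun k X hk hX => by
      obtain ⟨hRX, hbX, hzX⟩ := hX
      obtain ⟨hrr, hk0, hiX, _⟩ := book_eq (hbX.trans hbook)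
      obtain ⟨ε', hg'⟩ := good_gstep_iter hpm hg tgt k
      obtain ⟨ε'', hg''⟩ := good_gstep_iter hpm hg tgt (k + 1)
      have hTZ : TZ d r m X.rr = T := by rw [TZ_eq, hrr, hT]
      obtain ⟨h1, _⟩ := hRX.gstepM hpm C.hN hg'.inv hg'.red hTZ hT1 hl hlN hk0 hiX
      rw [← Function.iterate_succ_apply' (gstep pm tgt)] at h1
      exact (sm_of_rel h1 (asb_of_good hpm hg'' (hE (k + 1) hk)) (bookB_of ((gstepM_book (N := N) X).trans (hbX.trans hbook))
        hk₀ hi hzX.gstepM) C.hm).mono (wOf_le C.hN))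
    (S := S) ⟨hR, rfl, hz⟩
  exact ⟨key.1, key.2.1, key.2.2.1, key.2.2.2⟩

/-- **A reduction loop on related states.** [cite: JacobsonWilliams2008, §5.4] -/
theorem run_rstepLoop (C : RunCtx d r m N) {S : MS} {t : AS} {ε : ℝ} (hg : Good (pmOf d r m) t ε)
    (hR : Rel d r m (reduceF (pmOf d r m) (sqF (pmOf d r m) N t) 0) S)
    {k₀ i : ℕ} (hbook : S.book = (r2 r (2 * nOf d r m + 12), (k₀ : ℤ), (i : ℤ), ln2K (2 * nOf d r m + 12)))
    (hk₀ : k₀ ≤ 3 * nOf d r m + 12) (hi : i ≤ 3 * nOf d r m + 12) (hz : Zr S)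
    (hE : ∀ k, k ≤ N → |(reduceF (pmOf d r m) (sqF (pmOf d r m) N t) k).E| < 2 ^ (5 * nOf d r m + 28)) :
    (Prog.loop rstepBody).run N S.lay = ((MS.rstepM N)^[N] S).lay ∧
      Rel d r m (reduceF (pmOf d r m) (sqF (pmOf d r m) N t) N) ((MS.rstepM N)^[N] S) ∧
      ((MS.rstepM N)^[N] S).book = S.book ∧ Zr ((MS.rstepM N)^[N] S) := by
  set pm := pmOf d r m with hpmdef
  have hpm : pm.OK := C.hpm
  obtain ⟨_, hsΔ, _⟩ := caps d r m C.hN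
  have hfuel : 2 * Nat.size pm.Δ + 2 ≤ N := by show 2 * Nat.size (disc d) + 2 ≤ N; omega
  have hstep : ∀ k X, Rel d r m (reduceF pm (sqF pm N t) k) X → Rel d r m (reduceF pm (sqF pm N t) (k + 1)) (X.rstepM N) :=
    fun k X hRX => by
      obtain ⟨⟨ε', hg'⟩, hN', ha, _⟩ := reduce_iter_spec hpm hg hfuel k
      rw [reduceF_succ]
      exact hRX.rstepM hpm C.hN hg'.inv.1 (by exact_mod_cast ha.le) (Norm.abs_b_le hN' ha.le)
  have key := run_loop_of (N := N) (body := rstepBody) (F := MS.rstepM N)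
    (Q := fun k X => Rel d r m (reduceF pm (sqF pm N t) k) X ∧ X.book = S.book ∧ Zr X)
    (fun k X _ _ => run_rstepBody N X)
    (fun k X _ hX => ⟨hstep k X hX.1, (rstepM_book (N := N) X).trans hX.2.1, hX.2.2.rstepM⟩)
    (fun k X hk hX => by
      obtain ⟨hRX, hbX, hzX⟩ := hX
      obtain ⟨⟨ε', hg'⟩, hN', ha, _⟩ := reduce_iter_spec hpm hg hfuel (k + 1)
      exact (sm_of_rel (hstep k X hRX) (asb_of_goodI hg' hN' ha (hE (k + 1) hk))
        (bookB_of ((rstepM_book (N := N) X).trans (hbX.trans hbook)) hk₀ hi hzX.rstepM) C.hm).mono (wOf_le C.hN))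
    (S := S) ⟨hR, rfl, hz⟩
  exact ⟨key.1, key.2.1, key.2.2.1, key.2.2.2⟩

/-! ### Phase: the Euclid loops -/

/-- A Euclid round zeroes the scratch registers `ox, oy`. [folklore] -/
theorem invM_ox (x : ℤ) (X : MS) : (X.invM x).ox = 0 ∧ (X.invM x).oy = 0 := by
  unfold MS.invM; split_ifs <;> exact ⟨rfl, rfl⟩

/-- **A Euclid loop on a related frame** runs its rounds unclamped. [cite: KnuthTAOCP2, §4.5.2] -/
theorem run_euLoop (C : RunCtx d r m N) {xE : Ex} {gx : MS → ℤ}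
    (hrunB : ∀ X : MS, (invBlk xE).run N X.lay = (X.invM (gx X)).lay) {F : MS} {s : AS} (hRel : Rel d r m s F)
    (hA : ASB (nOf d r m) (disc d) s) {k₀ i : ℕ}
    (hbook : F.book = (r2 r (2 * nOf d r m + 12), (k₀ : ℤ), (i : ℤ), ln2K (2 * nOf d r m + 12)))
    (hk₀ : k₀ ≤ 3 * nOf d r m + 12) (hi : i ≤ 3 * nOf d r m + 12) (hFg : |F.g| ≤ disc d) (hFnu : |F.nu| ≤ disc d)
    (hFlam : F.lam = 0) {x y : ℤ} (hx1 : 1 ≤ x) (hxΔ : x ≤ disc d) (hy0 : 0 ≤ y) (hyΔ : y ≤ disc d)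
    (h0 : EuRel F (x, y, 0, 1 % x) F) (hgx : ∀ X : MS, X.euFrame = F.euFrame → gx X = x) :
    (Prog.loop (invBlk xE)).run N F.lay = ((fun X : MS => X.invM (gx X))^[N] F).lay := by
  have key := run_loop_of (N := N) (body := invBlk xE) (F := fun X : MS => X.invM (gx X))
    (Q := fun k X => EuRel F ((invStep x)^[k] (x, y, 0, 1 % x)) X)
    (fun k X _ _ => hrunB X)
    (fun k X _ hX => by rw [Function.iterate_succ_apply', hgx X hX.frame]; exact hX.step x)
    (fun k X _ hX => by
      have hX' : EuRel F ((invStep x)^[k + 1] (x, y, 0, 1 % x)) (X.invM (gx X)) := by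
        rw [Function.iterate_succ_apply', hgx X hX.frame]; exact hX.step x
      have hEB := euB_iterate (B := (disc d : ℤ)) hx1 hy0 hxΔ hyΔ (k + 1)
      obtain ⟨b1, b2, b3, b4, b5, b6, b7, b8⟩ := hEB
      have e := hX'.frame
      have hb := MS.book_of_euFrame e
      obtain ⟨hox, hoy⟩ := invM_ox (gx X) X
      have eg : (X.invM (gx X)).g = F.g := (congrArg MS.g e :)
      have enu : (X.invM (gx X)).nu = F.nu := (congrArg MS.nu e :)
      have elam : (X.invM (gx X)).lam = F.lam := (congrArg MS.lam e :)
      obtain ⟨hrr, hk0, hiX, hacc⟩ := book_eq (hb.trans hbook)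
      obtain ⟨hacc0', _⟩ := ln2P_bounds (2 * nOf d r m + 12) (2 * nOf d r m + 12)
      refine (sm_of_rel (hRel.of_euFrame e) hA ⟨?_, ?_, ?_, ?_, ?_, ?_, ?_, ?_, ?_, ?_, ?_, ?_, hox, hoy⟩ C.hm).mono
        (wOf_le C.hN)
      · rw [hiX, abs_of_nonneg (Int.natCast_nonneg i)]; exact_mod_cast hi
      · rw [hacc, ← ln2P_K]; exact hacc0'
      · rw [hacc, ← ln2P_K]; exact ln2P_lt _ _ le_rfl
      · rw [hrr]; exact abs_r2_lt (r_lt_two_pow d r m)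
      · rw [hk0, abs_of_nonneg (Int.natCast_nonneg k₀)]; exact_mod_cast hk₀
      · rw [eg]; exact hFg
      · rw [enu]; exact hFnu
      · rw [elam]; exact hFlam
      · rw [hX'.u, abs_of_nonneg b1]; exact b2
      · rw [hX'.v, abs_of_nonneg b3]; exact b4
      · rw [hX'.w, abs_of_nonneg b5]; exact b6.le.trans hxΔ
      · rw [hX'.t, abs_of_nonneg b7]; exact b8.le.trans hxΔ)
    (S := F) h0
  exact key.1

/-! ### Phase: one level -/

/-- `ν` of the squaring lies in `[0, a₁)`. [folklore] -/
theorem nu_bounds {pm : Prm} {S₀ : St} (ha1 : 1 ≤ S₀.a1) (hb1 : 0 ≤ S₀.b1) (fuel : ℕ) :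
    0 ≤ (sqData pm S₀ fuel).1.2 ∧ (sqData pm S₀ fuel).1.2 < S₀.a1 := by
  have := euB_iterate (B := max S₀.a1 S₀.b1) ha1 hb1 (le_max_left _ _) (le_max_right _ _) fuel
  exact ⟨this.2.2.2.2.1, this.2.2.2.2.2.1⟩

/-- After a Euclid loop (`N ≥ 1` rounds) the scratch registers `ox, oy` are zero. [folklore] -/
theorem eu_ox {gx : MS → ℤ} (F : MS) (hN : 1 ≤ N) :
    ((fun X : MS => X.invM (gx X))^[N] F).ox = 0 ∧ ((fun X : MS => X.invM (gx X))^[N] F).oy = 0 := by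
  obtain ⟨N', rfl⟩ : ∃ N', N = N' + 1 := ⟨N - 1, by omega⟩
  rw [Function.iterate_succ_apply']
  exact invM_ox _ _

/-- The machine level: `i += 1; square; normalise; N reduction rounds; N walk rounds`. [folklore] -/
def MS.levelCore (N : ℕ) (S : MS) : MS :=
  (MS.gstepM N)^[N] ((MS.rstepM N)^[N] ((({ S with i := S.i + 1 } : MS).sqM N).normM))

/-- **One level on related states.** [cite: JacobsonWilliams2008, §12.2 (Alg. 12.6, one iteration)] -/
theorem run_levelCore (C : RunCtx d r m N) {S : MS} {s : AS} {ε : ℝ} (hR : Rel d r m s S)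
    (hg : Good (pmOf d r m) s ε) {k₀ j : ℕ}
    (hbook : S.book = (r2 r (2 * nOf d r m + 12), (k₀ : ℤ), (j : ℤ), ln2K (2 * nOf d r m + 12)))
    (hk₀ : k₀ ≤ 3 * nOf d r m + 12) (hj : j + 1 ≤ 3 * nOf d r m + 12) (hz : Zr S) {T : ℤ}
    (hT : T = r2 r (2 * nOf d r m + 12) - 4 * nOf d r m) (hT1 : 1 ≤ T) (hEs : |s.E| ≤ EBz (nOf d r m) N j) :
    levelsCore.run N S.lay = (S.levelCore N).lay ∧
      Rel d r m (level (lpOf d r m N T) (k₀ + j + 1) s) (S.levelCore N) ∧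
      (S.levelCore N).book = (r2 r (2 * nOf d r m + 12), (k₀ : ℤ), ((j + 1 : ℕ) : ℤ), ln2K (2 * nOf d r m + 12)) ∧
      Zr (S.levelCore N) := by
  set n := nOf d r m with hn
  set pm := pmOf d r m with hpmdef
  set K := 2 * n + 12 with hK
  have hpm : pm.OK := C.hpm
  obtain ⟨hn4, hsΔ, _⟩ := caps d r m C.hN
  have hfuel : 2 * Nat.size pm.Δ + 2 ≤ N := by show 2 * Nat.size (disc d) + 2 ≤ N; have := C.hN; omega
  have hn1 : Nat.size pm.Δ + 1 ≤ N := by show Nat.size (disc d) + 1 ≤ N; have := C.hN; omega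
  have hN1 : 1 ≤ N := by have := C.hN; omega
  obtain ⟨_, _, _, hg1, hgΔ, ha1, ha1Δ, hb1, hb1Δ, hc1, hcΔ⟩ := hpm.sq_frame_bounds hg N
  have hI := hg.inv
  have hRd := hg.red
  obtain ⟨haΔ, _⟩ := Red.frame_bounds (Δ := disc d) hpm.disc hRd
  have hbpos := hRd.b_pos
  have hbΔ : s.fr.b ≤ disc d := by
    have hb2 : s.fr.b ^ 2 < ((disc d : ℕ) : ℤ) := hRd.b_sq_lt
    nlinarith
  have hΔ0 : (0 : ℤ) ≤ disc d := Int.natCast_nonneg _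
  -- exponent bounds
  have hjle : j ≤ 3 * n + 12 := by omega
  have hEB := EBz_lt (N := N) (j := j + 1) C.n4 C.hN' hj
  have hE0 : |s.E| < 2 ^ (5 * n + 28) := hEs.trans_lt ((EBz_mono n N (Nat.le_succ j)).trans_lt hEB)
  have hA : ASB n (disc d) s := asb_of_good hpm hg hE0
  have hC2 : (pm.C2 : ℤ) ≤ C2n n := by exact_mod_cast C2_le d r m
  have hC3 : (pm.C3 : ℤ) ≤ C3n n := by exact_mod_cast C3_le d r m
  have hNz : (0 : ℤ) ≤ N := Int.natCast_nonneg _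
  have hsucc := EBz_succ n N j
  have hC20 : (0 : ℤ) ≤ pm.C2 := Int.natCast_nonneg _
  have hNC : (N : ℤ) * pm.C2 ≤ N * C2n n := mul_le_mul_of_nonneg_left hC2 hNz
  have hNC0 : (0 : ℤ) ≤ N * C2n n := mul_nonneg hNz (Int.natCast_nonneg _)
  have hDn : (Dn n N : ℤ) = C3n n + 2 * N * C2n n := by unfold Dn; push_cast; ring
  have hEred : ∀ k, k ≤ N → |(reduceF pm (sqF pm N s) k).E| < 2 ^ (5 * n + 28) := fun k hk => by
    obtain ⟨_, _, _, h4⟩ := reduce_iter_spec hpm hg hfuel k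
    have hk' : (k : ℤ) ≤ N := by exact_mod_cast hk
    have hkC : (k : ℤ) * pm.C2 ≤ N * C2n n := (mul_le_mul_of_nonneg_right hk' hC20).trans hNC
    refine lt_of_le_of_lt ?_ hEB
    rw [hsucc, hDn]; linarith
  obtain ⟨ε6, hg6⟩ := good_reduce_sq hpm hg hfuel hn1
  set tgt := pref T (Nat.size T.toNat - 1) (k₀ + (j + 1)) - ((2 * n + 8 : ℕ) : ℤ) with htgt
  have hEg : ∀ k, k ≤ N → |((gstep pm tgt)^[k] (reduceF pm (sqF pm N s) N)).E| < 2 ^ (5 * n + 28) := fun k hk => by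
    have h1 := abs_gstep_iter_E hpm hg6 tgt k
    obtain ⟨_, _, _, h4⟩ := reduce_iter_spec hpm hg hfuel N
    have hk' : (k : ℤ) ≤ N := by exact_mod_cast hk
    have hkC : (k : ℤ) * pm.C2 ≤ N * C2n n := (mul_le_mul_of_nonneg_right hk' hC20).trans hNC
    refine lt_of_le_of_lt ?_ hEB
    rw [hsucc, hDn]; linarith
  -- the stages
  obtain ⟨hrr, hk0, hi, hacc⟩ := book_eq hbook
  set S1 : MS := { S with i := S.i + 1 } with hS1
  have hR1 : Rel d r m s S1 := hR.setI _
  have hz1 : Zr S1 := hz.setI _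
  have book1 : S1.book = (r2 r K, (k₀ : ℤ), ((j + 1 : ℕ) : ℤ), ln2K K) := by
    show (S.rr, S.k0, S.i + 1, S.acc) = _; rw [hrr, hk0, hi, hacc]; push_cast; rfl
  have SL := hR1.sq_loops hpm C.hN hg
  set F1 := S1.loadA with hF1
  have e0 : (Prog.set 12 (.add (.reg 12) (.cst 1))).run N S.lay = S1.lay := run_incI N S
  have e1 : (loadBlk (.reg 3) (.reg 4)).run N S1.lay = F1.lay := run_loadBlkA N S1
  have h01 : EuRel F1 ((s.fr.a : ℤ), s.fr.b, 0, 1 % (s.fr.a : ℤ)) F1 :=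
    ⟨rfl, hR.a, hR.b, rfl, by show 1 % S.a = _; rw [hR.a]⟩
  have e2 : (Prog.loop (invBlk (.reg 3))).run N F1.lay = (F1.eu1 N).lay :=
    run_euLoop C (xE := .reg 3) (gx := fun X => X.a) (run_invBlkA N) hR1.loadA hA book1 hk₀ hj
      (by rw [show F1.g = S.g from rfl, hz.g]; simp) (by rw [show F1.nu = S.nu from rfl, hz.nu]; simp) hz.lam
      (by exact_mod_cast hI.1) (by exact_mod_cast haΔ) (by omega) hbΔ h01
      (fun X hX => by have e : X.a = F1.a := (congrArg MS.a hX :); exact e.trans hR.a)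
  set X1 := F1.eu1 N with hX1
  have R1 : Rel d r m s X1 := hR1.loadA.of_euFrame SL.f1
  have hX1u : X1.u = s.fr.g := SL.u1
  have hX1nu : X1.nu = 0 := by have e : X1.nu = F1.nu := (congrArg MS.nu SL.f1 :); exact e.trans hz.nu
  have hX1lam : X1.lam = 0 := by have e : X1.lam = F1.lam := (congrArg MS.lam SL.f1 :); exact e.trans hz.lam
  have bookX1 : X1.book = _ := (MS.book_of_euFrame SL.f1).trans book1
  have e3 : sqMid1.run N X1.lay = X1.mid1.lay := run_sqMid1 N X1
  set F2 := X1.mid1 with hF2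
  have hF2g : F2.g = s.fr.g := hX1u
  have hF2u : F2.u = s.fr.a1 := by show X1.a / X1.u = _; rw [R1.a, hX1u]; rfl
  have hF2v : F2.v = s.fr.b1 := by show X1.b / X1.u = _; rw [R1.b, hX1u]; rfl
  have hF2t : F2.t = 1 % s.fr.a1 := by show 1 % (X1.a / X1.u) = _; rw [R1.a, hX1u]; rfl
  have h02 : EuRel F2 (s.fr.a1, s.fr.b1, 0, 1 % s.fr.a1) F2 := ⟨rfl, hF2u, hF2v, rfl, hF2t⟩
  have e4 : (Prog.loop (invBlk a1E)).run N F2.lay = (F2.eu2 N).lay :=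
    run_euLoop C (xE := a1E) (gx := fun X => X.a / X.g) (run_invBlk1 N) R1.mid1 hA bookX1 hk₀ hj
      (by rw [hF2g, abs_of_nonneg (by omega)]; exact hgΔ) (by rw [show F2.nu = X1.nu from rfl, hX1nu]; simp)
      hX1lam ha1 ha1Δ hb1 hb1Δ h02
      (fun X hX => by
        have ea : X.a = F2.a := (congrArg MS.a hX :)
        have eg : X.g = F2.g := (congrArg MS.g hX :)
        show X.a / X.g = s.fr.a1
        rw [ea, eg, hF2g, show F2.a = X1.a from rfl, R1.a]; rfl)
  set X2 := F2.eu2 N with hX2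
  have R2 : Rel d r m s X2 := R1.mid1.of_euFrame SL.f2
  have hX2g : X2.g = s.fr.g := by have e : X2.g = F2.g := (congrArg MS.g SL.f2 :); exact e.trans hF2g
  have hX2lam : X2.lam = 0 := by have e : X2.lam = F2.lam := (congrArg MS.lam SL.f2 :); exact e.trans hX1lam
  have bookX2 : X2.book = _ := (MS.book_of_euFrame SL.f2).trans bookX1
  have hX2w : X2.w = (sqData pm s.fr N).1.2 := SL.w2
  have e5 : sqMid2.run N X2.lay = X2.mid2.lay := run_sqMid2 N X2
  set F3 := X2.mid2 with hF3
  have hF3v : F3.v = s.fr.c (disc d) := by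
    show cZ X2.d X2.a X2.b = _; rw [R2.hd, R2.a, R2.b]; exact cZ_eq d _ _ s.fr.p s.fr.r
  have hF3t : F3.t = 1 % s.fr.g := by show 1 % X2.g = _; rw [hX2g]
  have h03 : EuRel F3 (s.fr.g, s.fr.c (disc d), 0, 1 % s.fr.g) F3 := ⟨rfl, hX2g, hF3v, rfl, hF3t⟩
  obtain ⟨hν0, hν⟩ := nu_bounds (pm := pm) ha1 hb1 N
  have e6 : (Prog.loop (invBlk (.reg 16))).run N F3.lay = (F3.eu3 N).lay :=
    run_euLoop C (xE := .reg 16) (gx := fun X => X.g) (run_invBlk2 N) R2.mid2 hA bookX2 hk₀ hj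
      (by rw [show F3.g = X2.g from rfl, hX2g, abs_of_nonneg (by omega)]; exact hgΔ)
      (by rw [show F3.nu = X2.w from rfl, hX2w, abs_of_nonneg hν0]; exact hν.le.trans ha1Δ)
      hX2lam hg1 hgΔ (by omega) hcΔ h03
      (fun X hX => by have e : X.g = F3.g := (congrArg MS.g hX :); exact e.trans hX2g)
  set X3 := F3.eu3 N with hX3
  have bookX3 : X3.book = _ := (MS.book_of_euFrame SL.f3).trans bookX2
  obtain ⟨hox3, hoy3⟩ := eu_ox (gx := fun X : MS => X.g) F3 hN1
  have e7 : sqPost.run N X3.lay = (X3.sqPostM N).lay := run_sqPost N X3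
  set X4 := X3.sqPostM N with hX4
  have R4 : Rel d r m (sqF pm N s) X4 := SL.sq.sqPostM hpm C.hN hg
  have hz4 : Zr X4 := Zr.sqPostM X3 hox3 hoy3
  have bookX4 : X4.book = (r2 r K, (k₀ : ℤ), ((j + 1 : ℕ) : ℤ), ln2K K) := bookX3
  have e8 : normBlk.run N X4.lay = X4.normM.lay := run_normBlk N X4
  set X5 := X4.normM with hX5
  have R5 : Rel d r m (reduceF pm (sqF pm N s) 0) X5 := R4.normM
  have hz5 : Zr X5 := hz4.normM
  have bookX5 : X5.book = (r2 r K, (k₀ : ℤ), ((j + 1 : ℕ) : ℤ), ln2K K) := bookX4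
  obtain ⟨e9, R6, book6, hz6⟩ := run_rstepLoop C hg R5 bookX5 hk₀ hj hz5 hEred
  set X6 := (MS.rstepM N)^[N] X5 with hX6
  obtain ⟨e10, R7, book7, hz7⟩ := run_gstepLoop C R6 hg6 (book6.trans bookX5) hk₀ hj hz6 hT hT1 hEg
  refine ⟨?_, R7, book7.trans (book6.trans bookX5), hz7⟩
  simp only [levelsCore, run_seq]
  rw [e0, e1, e2, e3, e4, e5, e6, e7, e8, e9, e10]
  rfl

/-! ### Phase: the levels -/

/-- The machine level with its guard. [folklore] -/
def MS.levelM (N : ℕ) (S : MS) : MS := if S.i < lZ S.d S.r S.m S.rr - S.k0 then S.levelCore N else S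

/-- **The levels loop on related states.** [cite: JacobsonWilliams2008, §12.2 (Alg. 12.6)] -/
theorem run_levelsLoop (C : RunCtx d r m N) {S : MS} {sA : AS} {εA : ℝ} (hR : Rel d r m sA S)
    (hgA : Good (pmOf d r m) sA εA) (hEA : |sA.E| ≤ A0 (nOf d r m) N) {k₀ : ℕ}
    (hbook : S.book = (r2 r (2 * nOf d r m + 12), (k₀ : ℤ), ((0 : ℕ) : ℤ), ln2K (2 * nOf d r m + 12)))
    (hk₀ : k₀ ≤ 3 * nOf d r m + 12) (hz : Zr S) {T : ℤ} (hT : T = r2 r (2 * nOf d r m + 12) - 4 * nOf d r m)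
    (hT1 : 1 ≤ T) :
    (Prog.loop levelsBody).run N S.lay = ((MS.levelM N)^[N] S).lay ∧
      Rel d r m (levels (lpOf d r m N T) k₀ (Nat.size T.toNat - 1 - k₀) sA) ((MS.levelM N)^[N] S) ∧
      (∃ i : ℕ, i ≤ 3 * nOf d r m + 12 ∧
        ((MS.levelM N)^[N] S).book = (r2 r (2 * nOf d r m + 12), (k₀ : ℤ), (i : ℤ), ln2K (2 * nOf d r m + 12))) ∧
      Zr ((MS.levelM N)^[N] S) := by
  set n := nOf d r m with hn
  set K := 2 * n + 12 with hK
  set l := Nat.size T.toNat - 1 with hl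
  set L' := l - k₀ with hL'
  set lp := lpOf d r m N T with hlp
  have hl' : l ≤ 3 * n + 11 := l_le d r m hT
  have hL'le : L' ≤ 3 * n + 11 := (Nat.sub_le l k₀).trans hl'
  have hLN : L' ≤ N := by have := C.hN; have := C.n4; omega
  have hspec := fun i => levels_spec' C.hd C.h2 C.hN T k₀ hgA hEA i
  have hEcap : ∀ i, i ≤ L' → |(levels lp k₀ i sA).E| < 2 ^ (5 * n + 28) := fun i hi =>
    (hspec i).2.trans_lt (EBz_lt C.n4 C.hN' (by omega))
  -- the guard
  have hguard : ∀ (j : ℕ) (X : MS), Rel d r m (levels lp k₀ (min j L') sA) X →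
      X.book = (r2 r K, (k₀ : ℤ), ((min j L' : ℕ) : ℤ), ln2K K) →
      (X.i < lZ X.d X.r X.m X.rr - X.k0 ↔ j < L') := fun j X hRX hbX => by
    obtain ⟨hrr, hk0, hi, _⟩ := book_eq hbX
    have hTZ : TZ d r m X.rr = T := by rw [TZ_eq, hrr, hT]
    rw [hRX.hd, hRX.hr, hRX.hm, lZ_eq d r m hTZ hT1, ← hl, hk0, hi]
    constructor
    · intro h; by_contra h'; push Not at h'; rw [min_eq_right h'] at h; omega
    · intro h; rw [min_eq_left h.le]; omega
  have key := run_loop_of (N := N) (body := levelsBody) (F := MS.levelM N)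
    (Q := fun j X => Rel d r m (levels lp k₀ (min j L') sA) X ∧
      X.book = (r2 r K, (k₀ : ℤ), ((min j L' : ℕ) : ℤ), ln2K K) ∧ Zr X)
    (fun j X _ hX => by
      obtain ⟨hRX, hbX, hzX⟩ := hX
      have hg' := hguard j X hRX hbX
      unfold levelsBody MS.levelM
      rw [run_ifp, eval_levelsGuard]
      by_cases hj : j < L'
      · rw [if_pos (hg'.mpr hj), if_neg one_ne_zero, if_pos (hg'.mpr hj)]
        obtain ⟨ε', hgj⟩ := (hspec (min j L')).1
        exact (run_levelCore C hRX hgj hbX hk₀ (by rw [min_eq_left hj.le]; omega) hzX hT hT1 (hspec _).2).1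
      · rw [if_neg (fun h => hj (hg'.mp h)), if_pos rfl, if_neg (fun h => hj (hg'.mp h))])
    (fun j X _ hX => by
      obtain ⟨hRX, hbX, hzX⟩ := hX
      have hg' := hguard j X hRX hbX
      unfold MS.levelM
      by_cases hj : j < L'
      · rw [if_pos (hg'.mpr hj)]
        obtain ⟨ε', hgj⟩ := (hspec (min j L')).1
        obtain ⟨_, hR', hb', hz'⟩ := run_levelCore C hRX hgj hbX hk₀ (by rw [min_eq_left hj.le]; omega) hzX hT hT1
          (hspec _).2
        have e : min (j + 1) L' = min j L' + 1 := by rw [min_eq_left hj.le, min_eq_left (by omega)]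
        refine ⟨?_, by rw [hb', e], hz'⟩
        rw [e]; exact hR'
      · rw [if_neg (fun h => hj (hg'.mp h))]
        have e : min (j + 1) L' = min j L' := by push Not at hj; rw [min_eq_right hj, min_eq_right (by omega)]
        rw [e]; exact ⟨hRX, hbX, hzX⟩)
    (fun j X _ hX => by
      obtain ⟨hRX, hbX, hzX⟩ := hX
      have hg' := hguard j X hRX hbX
      unfold MS.levelM
      by_cases hj : j < L'
      · rw [if_pos (hg'.mpr hj)]
        obtain ⟨ε', hgj⟩ := (hspec (min j L')).1
        obtain ⟨_, hR', hb', hz'⟩ := run_levelCore C hRX hgj hbX hk₀ (by rw [min_eq_left hj.le]; omega) hzX hT hT1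
          (hspec _).2
        obtain ⟨ε'', hgj'⟩ := (hspec (min j L' + 1)).1
        have hmin : min j L' + 1 ≤ L' := by rw [min_eq_left hj.le]; omega
        exact (sm_of_rel hR' (asb_of_good C.hpm hgj' (hEcap _ hmin)) (bookB_of hb' hk₀ (by omega) hz') C.hm).mono
          (wOf_le C.hN)
      · rw [if_neg (fun h => hj (hg'.mp h))]
        obtain ⟨ε'', hgj'⟩ := (hspec (min j L')).1
        exact (sm_of_rel hRX (asb_of_good C.hpm hgj' (hEcap _ (min_le_right _ _))) (bookB_of hbX hk₀ (by omega) hzX)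
          C.hm).mono (wOf_le C.hN))
    (S := S) ⟨by rw [Nat.zero_min]; exact hR, by rw [Nat.zero_min]; exact hbook, hz⟩
  obtain ⟨e, hRN, hbN, hzN⟩ := key
  rw [min_eq_right hLN] at hRN hbN
  exact ⟨e, hRN, ⟨L', by omega, hbN⟩, hzN⟩

/-! ### Phase: the final walk -/

/-- **The final walk on related states.** [cite: JacobsonWilliams2008, §7.4] -/
theorem run_finLoop (C : RunCtx d r m N) {S : MS} {sL : AS} (hR : Rel d r m sL S) (hI : Inv (disc d) sL.fr)
    (hRd : Red (disc d) sL.fr) (hA : ASB (nOf d r m) (disc d) sL) {k₀ i : ℕ}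
    (hbook : S.book = (r2 r (2 * nOf d r m + 12), (k₀ : ℤ), (i : ℤ), ln2K (2 * nOf d r m + 12)))
    (hk₀ : k₀ ≤ 3 * nOf d r m + 12) (hi : i ≤ 3 * nOf d r m + 12) (hz : Zr S) :
    (Prog.loop finBody).run N S.lay = (MS.finM^[N] S).lay ∧
      Rel d r m ((finStep (disc d))^[N] sL) (MS.finM^[N] S) := by
  have hpm := C.hpm
  have hiter : ∀ k, Inv (disc d) ((finStep (disc d))^[k] sL).fr ∧ Red (disc d) ((finStep (disc d))^[k] sL).fr ∧
      ((finStep (disc d))^[k] sL).M = sL.M ∧ ((finStep (disc d))^[k] sL).E = sL.E ∧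
      ((finStep (disc d))^[k] sL).sgn = sL.sgn := fun k => by
    obtain ⟨j, _, e⟩ := finStep_iterate_exists (disc d) sL k
    rw [e]; exact fstepAS_iterate_spec hpm.disc hI hRd j
  have key := run_loop_of (N := N) (body := finBody) (F := MS.finM)
    (Q := fun k X => Rel d r m ((finStep (disc d))^[k] sL) X ∧ X.book = S.book ∧ Zr X)
    (fun k X _ _ => run_finBody N X)
    (fun k X _ hX => by
      obtain ⟨hRX, hbX, hzX⟩ := hX
      obtain ⟨h1, h2, _⟩ := hiter k
      refine ⟨?_, (finM_book X).trans hbX, hzX.finM⟩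
      rw [Function.iterate_succ_apply']; exact hRX.finM h1 h2)
    (fun k X _ hX => by
      obtain ⟨hRX, hbX, hzX⟩ := hX
      obtain ⟨h1, h2, _⟩ := hiter k
      obtain ⟨h1', h2', hM, hE, hsgn⟩ := hiter (k + 1)
      have hR' : Rel d r m ((finStep (disc d))^[k + 1] sL) X.finM := by
        rw [Function.iterate_succ_apply']; exact hRX.finM h1 h2
      exact (sm_of_rel hR' (asb_of_inv_red hpm h1' h2' hA hM hE hsgn) (bookB_of ((finM_book X).trans (hbX.trans hbook))
        hk₀ hi hzX.finM) C.hm).mono (wOf_le C.hN))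
    (S := S) ⟨hR, rfl, hz⟩
  exact ⟨key.1, key.2.1⟩

/-! ### The whole run -/

/-- The bounds of `s₀`. [folklore] -/
theorem asb_s0 (C : RunCtx d r m N) : ASB (nOf d r m) (disc d) (s0 (pmOf d r m)) := by
  obtain ⟨hg, _⟩ := good_s0 C.hpm
  refine asb_of_good C.hpm hg ?_
  show |(-((pmOf d r m).P : ℤ))| < _
  rw [abs_neg, abs_of_nonneg (Int.natCast_nonneg _), pmOf_P]
  have : ((3 * nOf d r m + 16 : ℕ) : ℤ) < 2 ^ (3 * nOf d r m + 16) := natCast_lt_two_pow _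
  exact this.trans_le (pow_le_pow_right₀ (by norm_num) (by omega))

/-- **The register program computes the unit-residue algorithm**: on the inputs `d, r, m` with
parameter `N`, `64n ≤ N ≤ 128n`, the output registers hold `algo d r m N`.
[cite: JacobsonWilliams2008, Ch. 12 (Alg. 12.6), §7.4; AroraBarak2009, §1.3] -/
theorem run_prog (C : RunCtx d r m N) : ∃ S' : MS, prog.run N (MS.init d r m).lay = S'.lay ∧
    S'.ox = (((algo d r m N).1 : ℕ) : ℤ) ∧ S'.oy = (((algo d r m N).2 : ℕ) : ℤ) := by
  set n := nOf d r m with hn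
  set pm := pmOf d r m with hpmdef
  set K := 2 * n + 12 with hK
  have hpm : pm.OK := C.hpm
  have hn4 := C.n4
  obtain ⟨hg0, _⟩ := good_s0 hpm
  have hA0 := asb_s0 C
  -- ln2K and the initial state
  set B := MS.bare d r m (K : ℤ) (ln2K K) with hB
  have e1 : (Prog.set 12 (.cst 0)).run N (MS.init d r m).lay = (MS.init d r m).lay := run_setI0 N _
  have e2 : (Prog.set 13 (.cst 0)).run N (MS.init d r m).lay = (MS.init d r m).lay := run_setAcc0 N _
  have e3 : (Prog.loop ln2Body).run N (MS.init d r m).lay = B.lay := run_ln2Loop C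
  have e4 : initBlk.run N B.lay = (B.initM N).lay := run_initBlk N B
  set S₂ := B.initM N with hS₂
  obtain ⟨hR2, hrr2, hi2, hk02, hg2, hnu2, hlam2, hu2, hv2, hw2, ht2, hox2, hoy2, hacc2⟩ :=
    rel_initM (S := B) (N := N) C.hN rfl rfl rfl rfl
  have hz2 : Zr S₂ := ⟨hg2, hnu2, hlam2, hu2, hv2, hw2, ht2, hox2, hoy2⟩
  have hrr2' : S₂.rr = r2 r K := hrr2
  have hbook2 : S₂.book = (r2 r K, ((0 : ℕ) : ℤ), (K : ℤ), ln2K K) := by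
    show (S₂.rr, S₂.k0, S₂.i, S₂.acc) = _; rw [hrr2', hk02, hi2, hacc2]; rfl
  have hKle : K ≤ 3 * n + 12 := by omega
  -- the output
  have hout : ∀ (X : MS) (sF : AS), Rel d r m sF X →
      X.outM.ox = (((out d m sF).1 : ℕ) : ℤ) ∧ X.outM.oy = (((out d m sF).2 : ℕ) : ℤ) := fun X sF hRX => by
    obtain ⟨h1, h2⟩ := hRX.outM
    unfold out
    rw [h1, h2, Int.toNat_of_nonneg (Int.emod_nonneg _ (by have := C.hm; omega)),
      Int.toNat_of_nonneg (Int.emod_nonneg _ (by have := C.hm; omega))]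
    exact ⟨rfl, rfl⟩
  -- the algorithm, unfolded
  have halgo : algo d r m N = if r2 r K ≤ 16 * n then out d m (finWalk pm.Δ N (fstepAS pm.Δ (s0 pm)))
      else out d m (finWalk pm.Δ N (levels (lpOf d r m N (r2 r K - 4 * n)) (kz (r2 r K - 4 * n)
        (lpOf d r m N (r2 r K - 4 * n)).l ((lpOf d r m N (r2 r K - 4 * n)).c₀ + 1) N)
        ((lpOf d r m N (r2 r K - 4 * n)).l - kz (r2 r K - 4 * n) (lpOf d r m N (r2 r K - 4 * n)).l
          ((lpOf d r m N (r2 r K - 4 * n)).c₀ + 1) N)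
        (gwalk pm (pref (r2 r K - 4 * n) (lpOf d r m N (r2 r K - 4 * n)).l
          (kz (r2 r K - 4 * n) (lpOf d r m N (r2 r K - 4 * n)).l ((lpOf d r m N (r2 r K - 4 * n)).c₀ + 1) N) -
          (lpOf d r m N (r2 r K - 4 * n)).c₀) N (s0 pm)))) := rfl
  by_cases hsmall : r2 r K ≤ 16 * (n : ℤ)
  · -- small regulator
    have e5 : (Prog.ifp (.le (.reg 14) (.mul (.cst 16) nE)) bstepBlk).run N S₂.lay = S₂.bstepM.lay := by
      rw [run_ifp, eval_smallGuard, hR2.hd, hR2.hr, hR2.hm, nZ_eq, hrr2', if_pos hsmall, if_neg one_ne_zero,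
        run_bstepBlk]
    set S₃ := S₂.bstepM with hS₃
    have hR3 : Rel d r m (fstepAS (disc d) (s0 pm)) S₃ := hR2.bstepM hg0.inv hg0.red
    have hz3 : Zr S₃ := hz2.bstepM
    have hbook3 : S₃.book = (r2 r K, ((0 : ℕ) : ℤ), (K : ℤ), ln2K K) := hbook2
    have e6 : (Prog.ifp (.lt (.mul (.cst 16) nE) (.reg 14)) largeBlk).run N S₃.lay = S₃.lay := by
      rw [run_ifp, eval_largeGuard, hR3.hd, hR3.hr, hR3.hm, nZ_eq, show S₃.rr = S₂.rr from rfl, hrr2',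
        if_neg (not_lt.mpr hsmall), if_pos rfl]
    have hI3 : Inv (disc d) (fstepAS (disc d) (s0 pm)).fr := hg0.inv.bstep hg0.red
    have hRd3 : Red (disc d) (fstepAS (disc d) (s0 pm)).fr := hg0.red.bstep hpm.disc hg0.inv
    have hA3 : ASB n (disc d) (fstepAS (disc d) (s0 pm)) := asb_of_inv_red hpm hI3 hRd3 hA0 rfl rfl rfl
    obtain ⟨e7, hR7⟩ := run_finLoop C hR3 hI3 hRd3 hA3 hbook3 (by omega) hKle hz3
    set S₄ := MS.finM^[N] S₃ with hS₄
    have e8 : outBlk.run N S₄.lay = S₄.outM.lay := run_outBlk N S₄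
    obtain ⟨hox, hoy⟩ := hout S₄ _ hR7
    refine ⟨S₄.outM, ?_, ?_, ?_⟩
    · unfold prog; simp only [run_seq]; rw [e1, e2, e3, e4, e5, e6, e7, e8]
    · rw [hox, halgo, if_pos hsmall]; rfl
    · rw [hoy, halgo, if_pos hsmall]; rfl
  · -- large regulator
    push Not at hsmall
    set T : ℤ := r2 r K - 4 * n with hT
    have hT1 : 1 ≤ T := by omega
    set l := Nat.size T.toNat - 1 with hl
    set k₀ := kz T l ((2 * n + 8 : ℕ) + 1) N with hk₀def
    have hk₀ : k₀ ≤ 3 * n + 12 := (kz_iter_le T l _ N).trans (by have := l_le d r m hT; omega)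
    have e5 : (Prog.ifp (.le (.reg 14) (.mul (.cst 16) nE)) bstepBlk).run N S₂.lay = S₂.lay := by
      rw [run_ifp, eval_smallGuard, hR2.hd, hR2.hr, hR2.hm, nZ_eq, hrr2', if_neg (not_le.mpr hsmall), if_pos rfl]
    -- the large block
    have f1 : (Prog.set 15 (.cst 0)).run N S₂.lay = S₂.lay := run_setK0 N S₂
    obtain hkz := run_kzLoop C hR2 hA0 hbook2 hKle hz2 hT hT1
    set S₅ : MS := { S₂ with k0 := (k₀ : ℤ) } with hS₅
    have f2 : (Prog.loop kzBody).run N S₂.lay = S₅.lay := hkz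
    set S₆ : MS := { S₅ with i := 0 } with hS₆
    have f3 : (Prog.set 12 (.cst 0)).run N S₅.lay = S₆.lay := run_setI0 N S₅
    have hR6 : Rel d r m (s0 pm) S₆ := (hR2.setK0 _).setI _
    have hz6 : Zr S₆ := (hz2.setK0 _).setI _
    have hbook6 : S₆.book = (r2 r K, (k₀ : ℤ), ((0 : ℕ) : ℤ), ln2K K) := by
      show (S₂.rr, (k₀ : ℤ), (0 : ℤ), S₂.acc) = _; rw [hrr2', hacc2]; rfl
    have hEA : ∀ k, k ≤ N → |((gstep pm (pref T l (k₀ + 0) - (2 * n + 8 : ℕ)))^[k] (s0 pm)).E| < 2 ^ (5 * n + 28) :=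
      fun k hk => by
        have h1 := abs_gstep_iter_E hpm hg0 (pref T l (k₀ + 0) - (2 * n + 8 : ℕ)) k
        have hE0 : |(s0 pm).E| = pm.P := by
          show |(-(pm.P : ℤ))| = _; rw [abs_neg, abs_of_nonneg (Int.natCast_nonneg _)]
        have hC2 : (pm.C2 : ℤ) ≤ C2n n := by exact_mod_cast C2_le d r m
        have hk' : (k : ℤ) ≤ N := by exact_mod_cast hk
        have hC20 : (0 : ℤ) ≤ pm.C2 := Int.natCast_nonneg _
        have hkC : (k : ℤ) * pm.C2 ≤ N * C2n n :=
          (mul_le_mul_of_nonneg_right hk' hC20).trans (mul_le_mul_of_nonneg_left hC2 (Int.natCast_nonneg _))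
        have hA0le := A0_le_EBz n N 0
        have hlt := EBz_lt (j := 0) C.n4 C.hN' (by omega)
        have hP : (pm.P : ℤ) = 3 * n + 16 := by rw [show pm.P = 3 * n + 16 from rfl]; push_cast; ring
        have hA0eq : ((A0 n N : ℕ) : ℤ) = 3 * n + 16 + N * C2n n := by unfold A0; push_cast; ring
        linarith
    obtain ⟨f4, hR7, hbook7, hz7⟩ := run_gstepLoop C hR6 hg0 hbook6 hk₀ (by omega) hz6 hT hT1 hEA
    set S₇ := (MS.gstepM N)^[N] S₆ with hS₇
    obtain ⟨εA, hgA⟩ := good_gstep_iter hpm hg0 (pref T l (k₀ + 0) - (2 * n + 8 : ℕ)) N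
    have hEA' : |((gstep pm (pref T l (k₀ + 0) - (2 * n + 8 : ℕ)))^[N] (s0 pm)).E| ≤ A0 n N := by
      have h1 := abs_gstep_iter_E hpm hg0 (pref T l (k₀ + 0) - (2 * n + 8 : ℕ)) N
      have hE0 : |(s0 pm).E| = pm.P := by
        show |(-(pm.P : ℤ))| = _; rw [abs_neg, abs_of_nonneg (Int.natCast_nonneg _)]
      have hC2 : (pm.C2 : ℤ) ≤ C2n n := by exact_mod_cast C2_le d r m
      have hNC : (N : ℤ) * pm.C2 ≤ N * C2n n := mul_le_mul_of_nonneg_left hC2 (Int.natCast_nonneg _)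
      have hP : (pm.P : ℤ) = 3 * n + 16 := by rw [show pm.P = 3 * n + 16 from rfl]; push_cast; ring
      have hA0eq : ((A0 n N : ℕ) : ℤ) = 3 * n + 16 + N * C2n n := by unfold A0; push_cast; ring
      linarith
    obtain ⟨f5, hR8, ⟨i8, hi8, hbook8⟩, hz8⟩ := run_levelsLoop C hR7 hgA hEA' (hbook7.trans hbook6) hk₀ hz7 hT hT1
    set S₈ := (MS.levelM N)^[N] S₇ with hS₈
    have e6 : (Prog.ifp (.lt (.mul (.cst 16) nE) (.reg 14)) largeBlk).run N S₂.lay = S₈.lay := by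
      rw [run_ifp, eval_largeGuard, hR2.hd, hR2.hr, hR2.hm, nZ_eq, hrr2', if_pos hsmall, if_neg one_ne_zero]
      unfold largeBlk; simp only [run_seq]; rw [f1, f2, f3, f4, f5]
    -- the final walk
    obtain ⟨⟨εL, hgL⟩, hEL⟩ := levels_spec' C.hd C.h2 C.hN T k₀ hgA hEA' (l - k₀)
    have hAL := asb_of_good hpm hgL (hEL.trans_lt (EBz_lt C.n4 C.hN' (by have := l_le d r m hT; omega)))
    obtain ⟨e7, hR9⟩ := run_finLoop C hR8 hgL.inv hgL.red hAL hbook8 hk₀ hi8 hz8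
    set S₉ := MS.finM^[N] S₈ with hS₉
    have e8 : outBlk.run N S₉.lay = S₉.outM.lay := run_outBlk N S₉
    obtain ⟨hox, hoy⟩ := hout S₉ _ hR9
    refine ⟨S₉.outM, ?_, ?_, ?_⟩
    · unfold prog; simp only [run_seq]; rw [e1, e2, e3, e4, e5, e6, e7, e8]
    · rw [hox, halgo, if_neg (not_le.mpr hsmall)]; rfl
    · rw [hoy, halgo, if_neg (not_le.mpr hsmall)]; rfl

end Steps

end Literature.Computability.Cryptography.UnitResidue
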